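import Literature.NumberTheory.LFunctions.ExplicitLandauRepulsionStechkin
import Literature.NumberTheory.LFunctions.ExplicitLandauPageFamilyProofs
import Literature.NumberTheory.LFunctions.GeneralizedRH
import HarnessLib

/-!
# Two real zeros of ONE real character repel: an explicit Page-type bound by McCurley's method with
# Stechkin's device (DERIVED), and Thorner–Zaman's Corollary 2.5 from Platt's computation alone

Topic `Literature/NumberTheory/LFunctions` (namespace `Literature.NumberTheory.LFunctions`;
sub-namespaces `DirichletTheta`, `McCurleyStechkin` as in `ExplicitLandauRepulsionStechkin.lean`).
Everything here is PROVED (standard axioms); no definition, no named fact is introduced.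

K. S. McCurley, *Explicit zero-free regions for Dirichlet L-functions*, J. Number Theory **19**
(1984) 7–32, Theorem 1 (p. 8): "Let `M = max{k, k|t|, 10}` and `R = 9.645908801`. Then
`𝓛_k(s) = ∏_{χ mod k} L(s, χ)` has at most a single zero in the region `{s : σ > 1 − 1/(R log M)}`.
The only possible zero in this region is a simple real zero arising from an `L`-function formed
with a real non-principal character modulo `k`." In particular two distinct real zeros `β₁, β₂` of
`L(s, χ)`, `χ` real non-principal mod `k`, satisfy `min{β₁, β₂} ≤ 1 − 1/(R log max{k, 10})`
(Page's theorem [Page 1935, McCurley's ref. 8] made explicit). The same paper's §3 proves the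
two-character analogue (Theorem 2, Landau's theorem) with the much better constant
`1/R₁ = (15 − 10√2)/(5 − √5) = 0.3103…` by Stechkin's device; that proof is formalized in
`ExplicitLandauRepulsionStechkin.lean` (`McCurley1984_theorem2_holds`).

**This file runs McCurley's §3 argument for a single real character** (positivity of
`Σ_n Λ(n)(n^{−σ} − κn^{−σ₁})(1 + χ(n))` in place of his (23), both real zeros kept in the
Stechkin-differenced Hadamard bound in place of his Lemma 10) and obtains, for EVERY modulus
`q ≥ 3` and every real non-principal (= quadratic, `≠ 1`, possibly imprimitive) `χ mod q`:

* `McCurleyStechkin.twoRealZeros_lt_landauWindow`: if `β₁ ≠ β₂` are real zeros of `L(s, χ)`, then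
  `min{β₁, β₂} < 1 − (1/R₁)/log q` (`1/R₁ = ThornerZaman2024.landauConst`).

This statement is DERIVED HERE; it is not printed in this form (McCurley prints the real-zero
clause of Theorem 1 with `1/R = 0.1036…` and `log max{k, 10}`; the method of his Theorem 2 gives
`1/R₁` for one character with room to spare — asymptotically `2/R₁`). It is exactly the
"same-character" input (binder `hPage`, any constant `> pageConst = 1/(2R₁)`) of the tree's
derivation `thornerZaman2024_corollary25_of_lemma24_platt_singlePage` of J. Thorner, A. Zaman,
Forum Math. **36** (2024), Corollary 2.5, hitherto fed by the named fact
`morrillTrudgian2020_theorem2` (`SingleCharacterPageExplicit.lean`). Consequently: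

* `thornerZaman2024_corollary25_of_platt : platt2016_theorem71 → platt2016_theorem72 →
  thornerZaman2024_corollary25` — Thorner–Zaman's explicit Page theorem for the family `q ≤ Q`
  now rests on Platt's 2016 computation (Math. Comp. 85, Theorems 7.1–7.2, named facts) ALONE:
  Lemma 2.4 is `thornerZaman2024_lemma24_of_mccurley2 McCurley1984_theorem2_holds` and the
  same-character clause is the theorem above;
* `thornerZaman2024_theorem26a_of_mccurleyClosed_platt_rh`: the Theorem 2.6 (first assertion)
  derivation of `ExplicitLandauPageFamilyProofs.lean` with its Lemma 2.4 hypothesis discharged.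

* `thornerZaman2024_corollary25_first`: the FIRST clause of Corollary 2.5 (uniqueness of the real
  zero / character in the window `s ≥ 1 − pageConst/log Q` among all primitive quadratic characters
  of modulus `≤ Q`, every `Q ≥ 3`) PROVED UNCONDITIONALLY — McCurley's Theorem 2 has no modulus
  threshold (`max{qq'/17, 13} ≤ Q²` once `Q² ≥ 13`; below that both moduli are `3`), so Platt's
  computation is needed only for the second clause `q > 400 000`.

* `McCurleyStechkin.realZeros_quadratic_sameModulus`: the modulus-`k` form (the real-character part
  of the real-zero clause of McCurley's Theorem 1, with `pageConst = 1/(2R₁) = 0.155…` in place of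
  the printed `1/R = 0.1036…`): for `k ≥ 3`, quadratic `χ, χ' ≠ 1` mod `k` with real zeros
  `β, β' ≥ 1 − pageConst/log k` have `β = β'` and `χ = χ'`.

* `McCurleyStechkin.deriv_ne_zero_of_mccurleyClosed`, `thornerZaman2024_theorem26_simple_of_mccurleyClosed_platt`:
  the "simple" clauses of McCurley's Theorem 1 and Thorner–Zaman's Theorem 2.6, proved modulo the
  named fact `McCurley1984_theorem1_closed` (which supplies "real, from a quadratic character") and,
  for the family form, Platt's Theorems 7.1–7.2.

The same argument with ONE real zero of multiplicity `≥ 2` kept twice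
(`DirichletTheta.four_mul_stechkinPair_le_of_two_le_zeroOrder`, `main_inequality_double`) gives the
SIMPLICITY clause of McCurley's Theorem 1 / Thorner–Zaman's Corollary 2.5 ("`β₁(Q)` is a simple
zero"), which the tree's named facts do not render:

* `McCurleyStechkin.deriv_ne_zero_of_realZero_landauWindow`: for `q ≥ 3`, `χ` quadratic `≠ 1`
  mod `q`, a real zero `β ≥ 1 − (1/R₁)/log q` of `L(s,χ)` has `L'(β,χ) ≠ 0`;
* `thornerZaman2024_corollary25_simple_of_platt`: for `Q ≥ 3`, a primitive quadratic `χ mod q ≤ Q`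
  and a real zero `β ≥ 1 − pageConst/log Q`, `L'(β,χ) ≠ 0` (modulo Platt's Theorems 7.1–7.2, which
  give `q > 400 000`).

## The argument (all constants proved in `ExplicitLandauRepulsionStechkin.lean`)

For `χ` primitive quadratic mod `k`, `χ ≠ 1`, distinct real zeros `β₁, β₂ ∈ (½, 1)` and
`1 < σ ≤ 1.3`, `σ₁ = (1 + √(1+4σ²))/2`, `κ = 1/√5`, `K = (1−κ)/2`:
`0 ≤ f_ζ(σ) + f_χ(σ)` (`positivity_sum_single`), `f_ζ(σ) ≤ 1/(σ−1) − 0.325` (`zetaTerm_le`),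
`f_χ(σ) ≤ K log k − 0.44 − P(σ,β₁) − P(σ,β₂)` (`DirichletTheta.two_mul_stechkinPair_add_le`: the four
Hadamard indices through `β₁, 1−β₁, β₂, 1−β₂` are distinct and every pair term is non-negative by
Stechkin's lemma; `gammaTerm_le`), `P(σ,β) ≥ 1/(σ−β)` (`inv_sub_le_stechkinPair`), whence
`1/(σ−β₁) + 1/(σ−β₂) − 1/(σ−1) ≤ K log k − 0.765` (`main_inequality_single`). An imprimitive `χ`
mod `q` is replaced by the primitive character inducing it (same real zeros in `(0,1)`,
`LFunction_eq_zero_iff_primitiveCharacter`; conductor `k ≤ q`). If both `β_i ≥ 1 − c/L`, `c = 1/R₁`,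
`L = log q > 1`: when `r = (√2−1)/(2K) ≤ 0.3L` take `σ = 1 + r/L`, so that (`key_identity`)
`2KL ≤ 1/(σ−β₁) + 1/(σ−β₂) − 1/(σ−1) ≤ KL − 0.765`, impossible; otherwise `L < 2.4984`, take
`σ = 1.3`: `2L/(0.3L + c) − 10/3 ≤ KL − 0.765` is impossible on `1 < L < 2.4984` (`c < 0.311`,
`K < 0.276395`, an elementary quadratic inequality). This endgame (`endgame`) is shared with
the multiple-zero case (`β₁ = β₂ = β`, `m_χ(β) ≥ 2`, multiplicity transferred to the primitive
character by `L(s,χ) = L(s,χ*)·∏_{p∣q}(1 − χ*(p)p^{−s})` with non-vanishing analytic Euler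
factors on `Re s > 0`).

## References

* K. S. McCurley, J. Number Theory 19 (1984) 7–32: Theorem 1 (p. 8, real-zero clause), §3
  (23)–(26) (the method), Lemmas 4, 8–10. [McCurley1984ZFR]
* J. Thorner, A. Zaman, Forum Math. 36 (2024): Lemma 2.4, Corollary 2.5, Theorem 2.6.
  [ThornerZaman2024LogFree]
* D. J. Platt, Math. Comp. 85 (2016), Theorems 7.1–7.2 (named facts, the remaining inputs).
  [Platt2016GRH]
* T. Morrill, T. Trudgian, J. Number Theory 212 (2020), Theorem 2 (the refereed `0.933/log q`,
  stronger, NOT proved here; §1 for the reduction to primitive characters). [MorrillTrudgian2020]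
* H. Davenport, *Multiplicative Number Theory*, ch. 5 (2)–(3), ch. 14. [DavenportMNT1980]
-/

noncomputable section

open Real Complex

namespace Literature.NumberTheory.LFunctions

/-! ## Two real zeros kept in the Stechkin-differenced Hadamard bound -/

namespace DirichletTheta

open McCurleyStechkin

variable {q : ℕ} [NeZero q] {χ : DirichletCharacter ℂ q}

/-- `Ξ_χ(t) ≠ 0` for real `t > 1` (the zeros have real part in `(0,1)`).
[cite: DavenportMNT1980, ch. 14] -/
private theorem xiPair_ofReal_ne_zero₂ (hχ : χ.IsPrimitive) (h1 : χ ≠ 1) {t : ℝ} (ht : 1 < t) :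
    xiPair χ t ≠ 0 := by
  intro h
  have := (re_mem_Ioo_of_xiPair_eq_zero hχ h1 h).2
  simp only [ofReal_re] at this
  linarith

/-- A real zero of `L(s, χ)` is a zero of `L(s, χ̄)` (`χ ≠ 1`). [cite: DavenportMNT1980, ch. 14] -/
private theorem LFunction_inv_ofReal_eq_zero₂ (h1 : χ ≠ 1) {β : ℝ} (hL : χ.LFunction β = 0) :
    χ⁻¹.LFunction β = 0 := by
  have h := DirichletZFR.conj_LFunction_conj χ h1 (β : ℂ)
  rw [Complex.conj_ofReal, hL, map_zero] at h
  exact h.symm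

/-- A real zero `β > 0` of `L(s, χ)` is a zero of `Ξ_χ` (`χ ≠ 1`). [cite: DavenportMNT1980, ch. 14] -/
private theorem xiPair_ofReal_eq_zero₂ (h1 : χ ≠ 1) {β : ℝ} (hβ0 : 0 < β)
    (hL : χ.LFunction β = 0) : xiPair χ β = 0 := by
  have hs : ∀ n : ℕ, (β : ℂ) + charParity χ ≠ -(2 * n) := by
    intro n h
    have h' := congrArg Complex.re h
    simp at h'
    have : (0 : ℝ) ≤ n := Nat.cast_nonneg n
    have hκ : (0 : ℝ) ≤ charParity χ := Nat.cast_nonneg _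
    linarith
  show dirichletXi χ β * dirichletXi χ⁻¹ β = 0
  rw [(dirichletXi_eq_zero_iff h1 hs).2 hL, zero_mul]

/-- `1/(t − β) + 1/(t − (1 − β))` as a complex number is real. [folklore] -/
private theorem inv_add_inv_ofReal₂ (t β : ℝ) :
    ((t : ℂ) - (β : ℂ))⁻¹ + ((t : ℂ) - (1 - (β : ℂ)))⁻¹ =
      ((1 / (t - β) + 1 / (t - 1 + β) : ℝ) : ℂ) := by
  have e1 : (t : ℂ) - (β : ℂ) = ((t - β : ℝ) : ℂ) := by push_cast; ring
  have e2 : (t : ℂ) - (1 - (β : ℂ)) = ((t - 1 + β : ℝ) : ℂ) := by push_cast; ring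
  rw [e1, e2, ← Complex.ofReal_inv, ← Complex.ofReal_inv, ← Complex.ofReal_add]
  push_cast
  ring

/-- **Stechkin-differenced partial fractions of `Ξ_χ`, two real zeros kept.** For `χ` primitive,
`χ ≠ 1`, two distinct real zeros `β₁, β₂ > ½` of `L(s, χ)` and real `σ > 1`, with
`σ₁ = (1+√(1+4σ²))/2`, `κ = 1/√5`,
`P(σ,β) = [1/(σ−β) + 1/(σ−1+β)] − κ[1/(σ₁−β) + 1/(σ₁−1+β)]`:
`2P(σ,β₁) + 2P(σ,β₂) ≤ Re Ξ_χ'/Ξ_χ(σ) − κ Re Ξ_χ'/Ξ_χ(σ₁)`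
(every Hadamard pair contributes a non-negative amount by Stechkin's lemma; the indices through
`β₁, 1−β₁` and through `β₂, 1−β₂` are pairwise distinct — `β₁ ≠ β₂`, `β₁ + β₂ > 1` — and at least
two pass through each zero, one from `ξ(·,χ)` and one from `ξ(·,χ̄)`).
[cite: McCurley1984ZFR, Lemmas 4, 8, 10] -/
theorem two_mul_stechkinPair_add_le (hχ : χ.IsPrimitive) (h1 : χ ≠ 1) {β₁ β₂ : ℝ}
    (hβ₁ : 1 / 2 < β₁) (hβ₂ : 1 / 2 < β₂) (hne : β₁ ≠ β₂) (hL₁ : χ.LFunction β₁ = 0)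
    (hL₂ : χ.LFunction β₂ = 0) {σ : ℝ} (hσ : 1 < σ) :
    2 * ((1 / (σ - β₁) + 1 / (σ - 1 + β₁)) -
        kappa * (1 / (sigmaOne σ - β₁) + 1 / (sigmaOne σ - 1 + β₁))) +
      2 * ((1 / (σ - β₂) + 1 / (σ - 1 + β₂)) -
        kappa * (1 / (sigmaOne σ - β₂) + 1 / (sigmaOne σ - 1 + β₂))) ≤
      (logDeriv (xiPair χ) σ).re - kappa * (logDeriv (xiPair χ) (sigmaOne σ)).re := by
  classical
  obtain ⟨b, hbs, -, hmult, hprod⟩ := exists_xiPair_hadamardSeq hχ h1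
  have h2 : xiPair χ 2 ≠ 0 := xiPair_two_ne_zero hχ h1
  have h1' : χ⁻¹ ≠ 1 := inv_ne_one.mpr h1
  have hσ₁ : 1 < sigmaOne σ := one_lt_sigmaOne hσ.le
  -- the series at a real point `t > 1`
  set T : ℝ → ℕ → ℂ := fun t n ↦
    -(2 * b n * ((t : ℂ) - 1 / 2)) / (1 - b n * (((t : ℂ) - 1 / 2) ^ 2 - 9 / 4)) with hTdef
  have hT : ∀ {t : ℝ}, 1 < t → logDeriv (xiPair χ) t = ∑' n, T t n :=
    fun ht ↦ logDeriv_xiPair_eq_tsum hbs h2 h1 hprod (xiPair_ofReal_ne_zero₂ hχ h1 ht)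
  have hTs : ∀ t : ℝ, Summable (T t) := fun t ↦
    summable_logDeriv_factor hbs (9 / 4) ((t : ℂ) - 1 / 2)
  have hTs' : ∀ t : ℝ, Summable fun n ↦ (T t n).re := fun t ↦
    (Complex.hasSum_re (hTs t).hasSum).summable
  have hfac : ∀ {t : ℝ}, 1 < t → ∀ n, 1 - b n * (((t : ℂ) - 1 / 2) ^ 2 - 9 / 4) ≠ 0 :=
    fun ht ↦ factor_ne_zero_of_xiPair_ne_zero h2 hprod (xiPair_ofReal_ne_zero₂ hχ h1 ht)
  have hTn : ∀ {t : ℝ}, 1 < t → ∀ n, b n ≠ 0 →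
      T t n = ((t : ℂ) - xiPairZero b n)⁻¹ + ((t : ℂ) - (1 - xiPairZero b n))⁻¹ :=
    fun ht n hn ↦ term_eq_inv_add_inv b hn (hfac ht n)
  have hρ : ∀ n, b n ≠ 0 → 0 < (xiPairZero b n).re ∧ (xiPairZero b n).re < 1 :=
    fun n hn ↦ re_mem_Ioo_of_xiPair_eq_zero hχ h1 (xiPair_xiPairZero h2 hprod hn)
  -- the combined term and its non-negativity (Stechkin's lemma)
  set g : ℕ → ℝ := fun n ↦ (T σ n).re - kappa * (T (sigmaOne σ) n).re with hgdef
  have hnonneg : ∀ n, 0 ≤ g n := by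
    intro n
    by_cases hn : b n = 0
    · simp [hgdef, hTdef, hn]
    · simp only [hgdef]
      rw [hTn hσ n hn, hTn hσ₁ n hn, add_re, add_re]
      obtain ⟨h0, h1''⟩ := hρ n hn
      have := stechkin_complex hσ.le h0 h1''
      linarith
  have hg : HasSum g ((∑' n, (T σ n).re) - kappa * ∑' n, (T (sigmaOne σ) n).re) :=
    (hTs' σ).hasSum.sub (((hTs' (sigmaOne σ)).hasSum).mul_left kappa)
  -- the value of `g` at an index through a real `β`
  have hvalT : ∀ {t : ℝ}, 1 < t → ∀ (β : ℝ) (n : ℕ), b n ≠ 0 →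
      (xiPairZero b n = β ∨ 1 - xiPairZero b n = β) →
        (T t n).re = 1 / (t - β) + 1 / (t - 1 + β) := by
    intro t ht β n hn h
    rw [hTn ht n hn]
    rcases h with h | h
    · rw [h, inv_add_inv_ofReal₂, ofReal_re]
    · have e : xiPairZero b n = 1 - (β : ℂ) := by rw [← h]; ring
      rw [e, sub_sub_cancel, add_comm, inv_add_inv_ofReal₂, ofReal_re]
  have hval : ∀ (β : ℝ) (n : ℕ), b n ≠ 0 → (xiPairZero b n = β ∨ 1 - xiPairZero b n = β) →
      g n = (1 / (σ - β) + 1 / (σ - 1 + β)) -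
        kappa * (1 / (sigmaOne σ - β) + 1 / (sigmaOne σ - 1 + β)) := by
    intro β n hn h
    simp only [hgdef]
    rw [hvalT hσ β n hn h, hvalT hσ₁ β n hn h]
  -- two distinct indices through each real zero `β > 1/2`
  have htwo : ∀ β : ℝ, 1 / 2 < β → χ.LFunction β = 0 →
      ∃ k k' : ℕ, k ≠ k' ∧ (b k ≠ 0 ∧ (xiPairZero b k = β ∨ 1 - xiPairZero b k = β)) ∧
        (b k' ≠ 0 ∧ (xiPairZero b k' = β ∨ 1 - xiPairZero b k' = β)) := by
    intro β hβ hLβ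
    have hβ0 : 0 < β := by linarith
    have hΞβ : xiPair χ (β : ℂ) = 0 := xiPair_ofReal_eq_zero₂ h1 hβ0 hLβ
    set A : Set ℕ := {k : ℕ | b k ≠ 0 ∧ xiPairZero b k = β} with hAdef
    set B : Set ℕ := {k : ℕ | b k ≠ 0 ∧ 1 - xiPairZero b k = β} with hBdef
    have hcard : A.ncard + B.ncard =
        DirichletDisc.zeroOrder χ β + DirichletDisc.zeroOrder χ⁻¹ β :=
      ncard_index_add_ncard_index_eq hχ h1 hmult hΞβ
    have hm1 : 0 < DirichletDisc.zeroOrder χ β := (DirichletDisc.zeroOrder_pos_iff χ h1 _).2 hLβ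
    have hm2 : 0 < DirichletDisc.zeroOrder χ⁻¹ β :=
      (DirichletDisc.zeroOrder_pos_iff χ⁻¹ h1' _).2 (LFunction_inv_ofReal_eq_zero₂ h1 hLβ)
    have hAB : Disjoint A B := by
      rw [Set.disjoint_left]
      rintro k ⟨-, hk⟩ ⟨-, hk'⟩
      rw [hk] at hk'
      have h' := congrArg Complex.re hk'
      simp only [sub_re, one_re, ofReal_re] at h'
      linarith
    have hPAB : ∀ k, k ∈ A ∪ B → b k ≠ 0 ∧ (xiPairZero b k = β ∨ 1 - xiPairZero b k = β) := by
      rintro k (⟨hk0, hk⟩ | ⟨hk0, hk⟩)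
      · exact ⟨hk0, Or.inl hk⟩
      · exact ⟨hk0, Or.inr hk⟩
    by_cases hfin : (A ∪ B).Finite
    · have hA : A.Finite := hfin.subset Set.subset_union_left
      have hB : B.Finite := hfin.subset Set.subset_union_right
      have hc : 1 < (A ∪ B).ncard := by
        rw [Set.ncard_union_eq hAB hA hB]; omega
      obtain ⟨k, k', hk, hk', hne'⟩ := (Set.one_lt_ncard_iff hfin).1 hc
      exact ⟨k, k', hne', hPAB k hk, hPAB k' hk'⟩
    · obtain ⟨k, hk, k', hk', hne'⟩ := Set.Infinite.nontrivial hfin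
      exact ⟨k, k', hne', hPAB k hk, hPAB k' hk'⟩
  -- indices through `β₁` and through `β₂` are distinct (`β₁ ≠ β₂`, `β₁ + β₂ ≠ 1`)
  have hsum : β₁ + β₂ ≠ 1 := by intro h; linarith
  have hsep : ∀ k, (xiPairZero b k = β₁ ∨ 1 - xiPairZero b k = β₁) →
      (xiPairZero b k = β₂ ∨ 1 - xiPairZero b k = β₂) → False := by
    intro k hk₁ hk₂
    rcases hk₁ with e₁ | e₁ <;> rcases hk₂ with e₂ | e₂
    · exact hne (by exact_mod_cast e₁.symm.trans e₂)
    · rw [e₁] at e₂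
      have h := congrArg Complex.re e₂
      simp only [sub_re, one_re, ofReal_re] at h
      exact hsum (by linarith)
    · rw [e₂] at e₁
      have h := congrArg Complex.re e₁
      simp only [sub_re, one_re, ofReal_re] at h
      exact hsum (by linarith)
    · exact hne (by exact_mod_cast e₁.symm.trans e₂)
  obtain ⟨k₁, k₂, h12, ⟨hk₁0, hk₁⟩, ⟨hk₂0, hk₂⟩⟩ := htwo β₁ hβ₁ hL₁
  obtain ⟨k₃, k₄, h34, ⟨hk₃0, hk₃⟩, ⟨hk₄0, hk₄⟩⟩ := htwo β₂ hβ₂ hL₂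
  have h13 : k₁ ≠ k₃ := by rintro rfl; exact hsep _ hk₁ hk₃
  have h14 : k₁ ≠ k₄ := by rintro rfl; exact hsep _ hk₁ hk₄
  have h23 : k₂ ≠ k₃ := by rintro rfl; exact hsep _ hk₂ hk₃
  have h24 : k₂ ≠ k₄ := by rintro rfl; exact hsep _ hk₂ hk₄
  have hsub : ∑ n ∈ ({k₁, k₂, k₃, k₄} : Finset ℕ), g n ≤
      (∑' n, (T σ n).re) - kappa * ∑' n, (T (sigmaOne σ) n).re :=
    sum_le_hasSum _ (fun n _ ↦ hnonneg n) hg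
  have hk₁nm : k₁ ∉ ({k₂, k₃, k₄} : Finset ℕ) := by simp [h12, h13, h14]
  have hk₂nm : k₂ ∉ ({k₃, k₄} : Finset ℕ) := by simp [h23, h24]
  rw [Finset.sum_insert hk₁nm, Finset.sum_insert hk₂nm, Finset.sum_pair h34,
    hval β₁ k₁ hk₁0 hk₁, hval β₁ k₂ hk₂0 hk₂, hval β₂ k₃ hk₃0 hk₃, hval β₂ k₄ hk₄0 hk₄] at hsub
  rw [hT hσ, hT hσ₁, Complex.re_tsum (hTs σ), Complex.re_tsum (hTs _)]
  linarith

/-- **McCurley's Lemma 10 in Stechkin-differenced form, two real zeros kept.** For `χ` primitive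
mod `q`, `χ ≠ 1`, parity `a`, distinct real zeros `β₁, β₂ > ½` of `L(s,χ)` and real `σ > 1`:
`Re(−L'/L(σ,χ)) − κRe(−L'/L(σ₁,χ)) ≤ K log q + [Re Γ_ℝ'/Γ_ℝ(σ+a) − κ Re Γ_ℝ'/Γ_ℝ(σ₁+a)]
  − P(σ,β₁) − P(σ,β₂)`. [cite: McCurley1984ZFR, Lemma 10] -/
theorem stechkinDiff_logDeriv_le_of_two_realZeros (hχ : χ.IsPrimitive) (h1 : χ ≠ 1) {β₁ β₂ : ℝ}
    (hβ₁ : 1 / 2 < β₁) (hβ₂ : 1 / 2 < β₂) (hne : β₁ ≠ β₂) (hL₁ : χ.LFunction β₁ = 0)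
    (hL₂ : χ.LFunction β₂ = 0) {σ : ℝ} (hσ : 1 < σ) :
    (-logDeriv χ.LFunction σ).re - kappa * (-logDeriv χ.LFunction (sigmaOne σ)).re ≤
      bigK * Real.log q + ((logDeriv Gammaℝ ((σ : ℂ) + charParity χ)).re
        - kappa * (logDeriv Gammaℝ ((sigmaOne σ : ℂ) + charParity χ)).re)
      - ((1 / (σ - β₁) + 1 / (σ - 1 + β₁)) -
          kappa * (1 / (sigmaOne σ - β₁) + 1 / (sigmaOne σ - 1 + β₁)))
      - ((1 / (σ - β₂) + 1 / (σ - 1 + β₂)) -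
          kappa * (1 / (sigmaOne σ - β₂) + 1 / (sigmaOne σ - 1 + β₂))) := by
  have hσ₁ : 1 < sigmaOne σ := one_lt_sigmaOne hσ.le
  have h0 := two_mul_stechkinPair_add_le hχ h1 hβ₁ hβ₂ hne hL₁ hL₂ hσ
  rw [re_logDeriv_xiPair_ofReal hχ h1 hσ, re_logDeriv_xiPair_ofReal hχ h1 hσ₁] at h0
  rw [neg_re, neg_re]
  unfold bigK
  nlinarith [h0, kappa_pos]

/-- **Stechkin-differenced partial fractions of `Ξ_χ`, a MULTIPLE real zero kept.** For `χ`
primitive quadratic, `χ ≠ 1`, a real zero `β > ½` of `L(s, χ)` of multiplicity `m_χ(β) ≥ 2` and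
real `σ > 1`: `4P(σ,β) ≤ Re Ξ_χ'/Ξ_χ(σ) − κ Re Ξ_χ'/Ξ_χ(σ₁)` — at least
`m_χ(β) + m_χ̄(β) = 2m_χ(β) ≥ 4` Hadamard indices pass through `β` or `1 − β`, each contributing
`P(σ,β) ≥ 0`. [cite: McCurley1984ZFR, Lemmas 4, 8, 10] -/
theorem four_mul_stechkinPair_le_of_two_le_zeroOrder (hχ : χ.IsPrimitive) (h1 : χ ≠ 1)
    (hq : χ.IsQuadratic) {β : ℝ} (hβ : 1 / 2 < β) (hm : 2 ≤ DirichletDisc.zeroOrder χ β)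
    {σ : ℝ} (hσ : 1 < σ) :
    4 * ((1 / (σ - β) + 1 / (σ - 1 + β)) -
        kappa * (1 / (sigmaOne σ - β) + 1 / (sigmaOne σ - 1 + β))) ≤
      (logDeriv (xiPair χ) σ).re - kappa * (logDeriv (xiPair χ) (sigmaOne σ)).re := by
  classical
  obtain ⟨b, hbs, -, hmult, hprod⟩ := exists_xiPair_hadamardSeq hχ h1
  have h2 : xiPair χ 2 ≠ 0 := xiPair_two_ne_zero hχ h1
  have hσ₁ : 1 < sigmaOne σ := one_lt_sigmaOne hσ.le
  -- the series at a real point `t > 1`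
  set T : ℝ → ℕ → ℂ := fun t n ↦
    -(2 * b n * ((t : ℂ) - 1 / 2)) / (1 - b n * (((t : ℂ) - 1 / 2) ^ 2 - 9 / 4)) with hTdef
  have hT : ∀ {t : ℝ}, 1 < t → logDeriv (xiPair χ) t = ∑' n, T t n :=
    fun ht ↦ logDeriv_xiPair_eq_tsum hbs h2 h1 hprod (xiPair_ofReal_ne_zero₂ hχ h1 ht)
  have hTs : ∀ t : ℝ, Summable (T t) := fun t ↦
    summable_logDeriv_factor hbs (9 / 4) ((t : ℂ) - 1 / 2)
  have hTs' : ∀ t : ℝ, Summable fun n ↦ (T t n).re := fun t ↦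
    (Complex.hasSum_re (hTs t).hasSum).summable
  have hfac : ∀ {t : ℝ}, 1 < t → ∀ n, 1 - b n * (((t : ℂ) - 1 / 2) ^ 2 - 9 / 4) ≠ 0 :=
    fun ht ↦ factor_ne_zero_of_xiPair_ne_zero h2 hprod (xiPair_ofReal_ne_zero₂ hχ h1 ht)
  have hTn : ∀ {t : ℝ}, 1 < t → ∀ n, b n ≠ 0 →
      T t n = ((t : ℂ) - xiPairZero b n)⁻¹ + ((t : ℂ) - (1 - xiPairZero b n))⁻¹ :=
    fun ht n hn ↦ term_eq_inv_add_inv b hn (hfac ht n)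
  have hρ : ∀ n, b n ≠ 0 → 0 < (xiPairZero b n).re ∧ (xiPairZero b n).re < 1 :=
    fun n hn ↦ re_mem_Ioo_of_xiPair_eq_zero hχ h1 (xiPair_xiPairZero h2 hprod hn)
  -- the combined term and its non-negativity (Stechkin's lemma)
  set g : ℕ → ℝ := fun n ↦ (T σ n).re - kappa * (T (sigmaOne σ) n).re with hgdef
  have hnonneg : ∀ n, 0 ≤ g n := by
    intro n
    by_cases hn : b n = 0
    · simp [hgdef, hTdef, hn]
    · simp only [hgdef]
      rw [hTn hσ n hn, hTn hσ₁ n hn, add_re, add_re]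
      obtain ⟨h0, h1''⟩ := hρ n hn
      have := stechkin_complex hσ.le h0 h1''
      linarith
  have hg : HasSum g ((∑' n, (T σ n).re) - kappa * ∑' n, (T (sigmaOne σ) n).re) :=
    (hTs' σ).hasSum.sub (((hTs' (sigmaOne σ)).hasSum).mul_left kappa)
  -- the value of `g` at an index through `β`
  have hvalT : ∀ {t : ℝ}, 1 < t → ∀ n : ℕ, b n ≠ 0 →
      (xiPairZero b n = β ∨ 1 - xiPairZero b n = β) →
        (T t n).re = 1 / (t - β) + 1 / (t - 1 + β) := by
    intro t ht n hn h
    rw [hTn ht n hn]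
    rcases h with h | h
    · rw [h, inv_add_inv_ofReal₂, ofReal_re]
    · have e : xiPairZero b n = 1 - (β : ℂ) := by rw [← h]; ring
      rw [e, sub_sub_cancel, add_comm, inv_add_inv_ofReal₂, ofReal_re]
  have hval : ∀ n : ℕ, b n ≠ 0 → (xiPairZero b n = β ∨ 1 - xiPairZero b n = β) →
      g n = (1 / (σ - β) + 1 / (σ - 1 + β)) -
        kappa * (1 / (sigmaOne σ - β) + 1 / (sigmaOne σ - 1 + β)) := by
    intro n hn h
    simp only [hgdef]
    rw [hvalT hσ n hn h, hvalT hσ₁ n hn h]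
  -- at least four indices through `β` or `1 − β`
  have hβ0 : 0 < β := by linarith
  have hLβ : χ.LFunction β = 0 := (DirichletDisc.zeroOrder_pos_iff χ h1 _).1 (by omega)
  have hΞβ : xiPair χ (β : ℂ) = 0 := xiPair_ofReal_eq_zero₂ h1 hβ0 hLβ
  set A : Set ℕ := {k : ℕ | b k ≠ 0 ∧ xiPairZero b k = β} with hAdef
  set B : Set ℕ := {k : ℕ | b k ≠ 0 ∧ 1 - xiPairZero b k = β} with hBdef
  have hcard : A.ncard + B.ncard =
      DirichletDisc.zeroOrder χ β + DirichletDisc.zeroOrder χ⁻¹ β :=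
    ncard_index_add_ncard_index_eq hχ h1 hmult hΞβ
  rw [hq.inv] at hcard
  have hAB : Disjoint A B := by
    rw [Set.disjoint_left]
    rintro k ⟨-, hk⟩ ⟨-, hk'⟩
    rw [hk] at hk'
    have h' := congrArg Complex.re hk'
    simp only [sub_re, one_re, ofReal_re] at h'
    linarith
  have hPAB : ∀ k, k ∈ A ∪ B → b k ≠ 0 ∧ (xiPairZero b k = β ∨ 1 - xiPairZero b k = β) := by
    rintro k (⟨hk0, hk⟩ | ⟨hk0, hk⟩)
    · exact ⟨hk0, Or.inl hk⟩
    · exact ⟨hk0, Or.inr hk⟩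
  obtain ⟨t, htS, htc⟩ : ∃ t : Finset ℕ, (↑t : Set ℕ) ⊆ A ∪ B ∧ t.card = 4 := by
    by_cases hfin : (A ∪ B).Finite
    · have hA : A.Finite := hfin.subset Set.subset_union_left
      have hB : B.Finite := hfin.subset Set.subset_union_right
      have hc : 4 ≤ (A ∪ B).ncard := by
        rw [Set.ncard_union_eq hAB hA hB]; omega
      rw [Set.ncard_eq_toFinset_card _ hfin] at hc
      obtain ⟨t, ht, htc⟩ := Finset.exists_subset_card_eq hc
      refine ⟨t, fun k hk ↦ ?_, htc⟩
      have := ht (Finset.mem_coe.1 hk)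
      simpa using this
    · exact Set.Infinite.exists_subset_card_eq hfin 4
  have hsub : ∑ n ∈ t, g n ≤ (∑' n, (T σ n).re) - kappa * ∑' n, (T (sigmaOne σ) n).re :=
    sum_le_hasSum _ (fun n _ ↦ hnonneg n) hg
  have hsum : ∑ n ∈ t, g n = 4 * ((1 / (σ - β) + 1 / (σ - 1 + β)) -
      kappa * (1 / (sigmaOne σ - β) + 1 / (sigmaOne σ - 1 + β))) := by
    rw [Finset.sum_congr rfl fun n hn ↦
      hval n (hPAB n (htS (Finset.mem_coe.2 hn))).1 (hPAB n (htS (Finset.mem_coe.2 hn))).2,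
      Finset.sum_const, htc, nsmul_eq_mul]
    norm_num
  rw [hT hσ, hT hσ₁, Complex.re_tsum (hTs σ), Complex.re_tsum (hTs _)]
  linarith

/-- **McCurley's Lemma 10 in Stechkin-differenced form, a multiple real zero kept.** For `χ`
primitive quadratic mod `q`, `χ ≠ 1`, parity `a`, a real zero `β > ½` with `m_χ(β) ≥ 2` and real
`σ > 1`:
`Re(−L'/L(σ,χ)) − κRe(−L'/L(σ₁,χ)) ≤ K log q + [Re Γ_ℝ'/Γ_ℝ(σ+a) − κ Re Γ_ℝ'/Γ_ℝ(σ₁+a)] − 2P(σ,β)`.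
[cite: McCurley1984ZFR, Lemma 10] -/
theorem stechkinDiff_logDeriv_le_of_two_le_zeroOrder (hχ : χ.IsPrimitive) (h1 : χ ≠ 1)
    (hq : χ.IsQuadratic) {β : ℝ} (hβ : 1 / 2 < β) (hm : 2 ≤ DirichletDisc.zeroOrder χ β)
    {σ : ℝ} (hσ : 1 < σ) :
    (-logDeriv χ.LFunction σ).re - kappa * (-logDeriv χ.LFunction (sigmaOne σ)).re ≤
      bigK * Real.log q + ((logDeriv Gammaℝ ((σ : ℂ) + charParity χ)).re
        - kappa * (logDeriv Gammaℝ ((sigmaOne σ : ℂ) + charParity χ)).re)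
      - 2 * ((1 / (σ - β) + 1 / (σ - 1 + β)) -
          kappa * (1 / (sigmaOne σ - β) + 1 / (sigmaOne σ - 1 + β))) := by
  have hσ₁ : 1 < sigmaOne σ := one_lt_sigmaOne hσ.le
  have h0 := four_mul_stechkinPair_le_of_two_le_zeroOrder hχ h1 hq hβ hm hσ
  rw [re_logDeriv_xiPair_ofReal hχ h1 hσ, re_logDeriv_xiPair_ofReal hχ h1 hσ₁] at h0
  rw [neg_re, neg_re]
  unfold bigK
  nlinarith [h0, kappa_pos]

end DirichletTheta

/-! ## Positivity for one character, the assembled inequality, and the conclusion -/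

namespace McCurleyStechkin

open DirichletCharacter ArithmeticFunction

variable {q : ℕ} [NeZero q]

/-- `fdiff` in `logDeriv` form. [folklore] -/
private theorem fdiff_eq_logDeriv₂ (χ : DirichletCharacter ℂ q) (σ : ℝ) :
    fdiff χ σ = (-logDeriv χ.LFunction σ).re - kappa * (-logDeriv χ.LFunction (sigmaOne σ)).re := by
  simp only [fdiff, logDeriv_apply]

omit [NeZero q] in
/-- A quadratic character has real values: `Im χ(a) = 0`, `Re χ(a) ∈ {0, 1, −1}`. [folklore] -/
private theorem re_cases₂ {χ : DirichletCharacter ℂ q} (hq : χ.IsQuadratic) (a : ZMod q) :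
    (χ a).im = 0 ∧ ((χ a).re = 0 ∨ (χ a).re = 1 ∨ (χ a).re = -1) := by
  rcases hq a with h | h | h <;> simp [h]

/-- The primitive character inducing a quadratic character is quadratic. [folklore] -/
private theorem primitiveCharacter_isQuadratic₂ {χ : DirichletCharacter ℂ q} (hq : χ.IsQuadratic) :
    χ.primitiveCharacter.IsQuadratic := by
  have hsq : χ.primitiveCharacter ^ 2 = 1 := by
    have h1 : changeLevel χ.conductor_dvd_level (χ.primitiveCharacter ^ 2) = 1 := by
      rw [map_pow, changeLevel_primitiveCharacter, hq.sq_eq_one]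
    exact (changeLevel_eq_one_iff _).1 h1
  intro a
  by_cases ha : IsUnit a
  · have h := congrArg (fun ψ : DirichletCharacter ℂ χ.conductor ↦ ψ a) hsq
    simp only [MulChar.pow_apply' _ two_ne_zero, MulChar.one_apply ha] at h
    rcases sq_eq_one_iff.1 h with h | h
    · exact Or.inr (Or.inl h)
    · exact Or.inr (Or.inr h)
  · exact Or.inl (MulChar.map_nonunit _ ha)

/-- **Positivity for one quadratic character** (McCurley's (23) with a single factor): for real
`σ > 1`, `0 ≤ f_ζ(σ) + f_χ(σ)`, the combined Dirichlet series being
`Σ_n Λ(n)(n^{−σ} − κ n^{−σ₁})(1 + χ(n))` with non-negative terms. [cite: McCurley1984ZFR, §3 (23)] -/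
theorem positivity_sum_single {χ : DirichletCharacter ℂ q} (hq : χ.IsQuadratic) {σ : ℝ}
    (hσ : 1 < σ) : 0 ≤ fdiffZeta σ + fdiff χ σ := by
  have hσ₁ : 1 < sigmaOne σ := one_lt_sigmaOne hσ.le
  have hσσ₁ : σ ≤ sigmaOne σ := (lt_sigmaOne (show (0 : ℝ) < σ by linarith)).le
  have Z0 := hasSum_vonMangoldt_zeta hσ
  have Z1 := hasSum_vonMangoldt_zeta hσ₁
  have A0 := hasSum_re_twist χ hσ
  have A1 := hasSum_re_twist χ hσ₁
  have hS := (Z0.sub (Z1.mul_left kappa)).add (A0.sub (A1.mul_left kappa))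
  have hval : fdiffZeta σ + fdiff χ σ =
      (-(deriv riemannZeta σ / riemannZeta σ)).re -
          kappa * (-(deriv riemannZeta (sigmaOne σ) / riemannZeta (sigmaOne σ))).re +
        ((-(deriv χ.LFunction σ / χ.LFunction σ)).re -
          kappa * (-(deriv χ.LFunction (sigmaOne σ) / χ.LFunction (sigmaOne σ))).re) := by
    unfold fdiffZeta fdiff
    ring
  rw [hval]
  refine hS.nonneg fun n ↦ ?_
  have hx := re_cases₂ hq (n : ZMod q)
  set x := (χ (n : ZMod q)).re with hxdef
  set a := (Λ n : ℝ) with hadef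
  set u := (n : ℝ) ^ σ with hudef
  set v := (n : ℝ) ^ sigmaOne σ with hvdef
  have ha : 0 ≤ a := vonMangoldt_nonneg
  have hw : 0 ≤ 1 / u - kappa * (1 / v) := by
    rcases Nat.eq_zero_or_pos n with hn | hn
    · have hu0 : u = 0 := by rw [hudef, hn, Nat.cast_zero, Real.zero_rpow (by linarith)]
      have hv0 : v = 0 := by rw [hvdef, hn, Nat.cast_zero, Real.zero_rpow (by linarith)]
      simp [hu0, hv0]
    · have hn1 : (1 : ℝ) ≤ n := by exact_mod_cast hn
      have hupos : 0 < u := Real.rpow_pos_of_pos (by linarith) _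
      have huv : u ≤ v := Real.rpow_le_rpow_of_exponent_le hn1 hσσ₁
      have h1 : 1 / v ≤ 1 / u := one_div_le_one_div_of_le hupos huv
      have h2 : 0 ≤ 1 / v := by positivity
      nlinarith [kappa_lt_one, kappa_pos]
  have hx' : 0 ≤ 1 + x := by rcases hx.2 with h | h | h <;> rw [h] <;> norm_num
  have key : 0 ≤ a * (1 / u - kappa * (1 / v)) * (1 + x) := mul_nonneg (mul_nonneg ha hw) hx'
  have e : a * (1 / u - kappa * (1 / v)) * (1 + x) =
      a / u - kappa * (a / v) + (a * x / u - kappa * (a * x / v)) := by ring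
  linarith [key, e]

/-- **The assembled inequality for one character (McCurley's (25), single factor, both real zeros
kept).** For `χ` primitive quadratic mod `k`, `χ ≠ 1`, distinct real zeros `β₁, β₂ ∈ (½, 1]` and
`1 < σ ≤ 1.3`: `1/(σ−β₁) + 1/(σ−β₂) − 1/(σ−1) ≤ K log k − 0.765`
(`f_ζ ≤ 1/(σ−1) − 0.325`, `f_χ ≤ K log k − 0.44 − P(σ,β₁) − P(σ,β₂)`, `P ≥ 1/(σ−β)`).
[cite: McCurley1984ZFR, §3 (23)–(25), Lemma 10] -/
theorem main_inequality_single {k : ℕ} [NeZero k] {χ : DirichletCharacter ℂ k}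
    (hp : χ.IsPrimitive) (hq : χ.IsQuadratic) (h1 : χ ≠ 1) {β₁ β₂ : ℝ}
    (hb1 : 1 / 2 < β₁) (hb1u : β₁ ≤ 1) (hz1 : χ.LFunction β₁ = 0)
    (hb2 : 1 / 2 < β₂) (hb2u : β₂ ≤ 1) (hz2 : χ.LFunction β₂ = 0) (hne : β₁ ≠ β₂)
    {σ : ℝ} (hσ : 1 < σ) (hσ' : σ ≤ 1.3) :
    1 / (σ - β₁) + 1 / (σ - β₂) - 1 / (σ - 1) ≤ bigK * Real.log k - 0.765 := by
  have hZ := zetaTerm_le hσ hσ'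
  have hC := DirichletTheta.stechkinDiff_logDeriv_le_of_two_realZeros hp h1 hb1 hb2 hne hz1 hz2 hσ
  rw [← fdiff_eq_logDeriv₂] at hC
  have hG := gammaTerm_le χ hσ hσ'
  have hP1 := inv_sub_le_stechkinPair hσ.le (by linarith) hb1u
  have hP2 := inv_sub_le_stechkinPair hσ.le (by linarith) hb2u
  have hpos := positivity_sum_single hq hσ
  unfold fdiffZeta at hpos
  linarith

/-- **The assembled inequality for one character with a MULTIPLE real zero.** For `χ` primitive
quadratic mod `k`, `χ ≠ 1`, a real zero `β ∈ (½, 1]` with `m_χ(β) ≥ 2` and `1 < σ ≤ 1.3`: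
`1/(σ−β) + 1/(σ−β) − 1/(σ−1) ≤ K log k − 0.765`. [cite: McCurley1984ZFR, §3 (23)–(25), Lemma 10] -/
theorem main_inequality_double {k : ℕ} [NeZero k] {χ : DirichletCharacter ℂ k}
    (hp : χ.IsPrimitive) (hq : χ.IsQuadratic) (h1 : χ ≠ 1) {β : ℝ}
    (hb : 1 / 2 < β) (hbu : β ≤ 1) (hm : 2 ≤ DirichletDisc.zeroOrder χ β)
    {σ : ℝ} (hσ : 1 < σ) (hσ' : σ ≤ 1.3) :
    1 / (σ - β) + 1 / (σ - β) - 1 / (σ - 1) ≤ bigK * Real.log k - 0.765 := by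
  have hZ := zetaTerm_le hσ hσ'
  have hC := DirichletTheta.stechkinDiff_logDeriv_le_of_two_le_zeroOrder hp h1 hq hb hm hσ
  rw [← fdiff_eq_logDeriv₂] at hC
  have hG := gammaTerm_le χ hσ hσ'
  have hP := inv_sub_le_stechkinPair hσ.le (by linarith) hbu
  have hpos := positivity_sum_single hq hσ
  unfold fdiffZeta at hpos
  linarith

/-- The elementary inequality of the small-modulus regime:
`(0.276395 L + 10/3 − 0.765)(0.3 L + 0.311)/2 ≤ L` for `1 ≤ L ≤ 2.4984`. [folklore] -/
private theorem smallRegime_aux {L : ℝ} (h1 : 1 ≤ L) (h2 : L ≤ 2.4984) :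
    (0.276395 * L - 0.765 + 10 / 3) / 2 * (0.3 * L + 0.311) ≤ L := by
  nlinarith [mul_nonneg (sub_nonneg.2 h1) (sub_nonneg.2 h2)]

/-- The small-modulus regime is contradictory: for `1 < L < 2.4984`, `0 < c < 0.311`,
`0 < K < 0.276395`, the inequality `2L/(0.3L + c) ≤ KL − 0.765 + 10/3` fails. [folklore] -/
private theorem smallRegime_contra {L c K : ℝ} (hL1 : 1 < L) (hLub : L < 2.4984) (hc0 : 0 < c)
    (hc1 : c < 0.311) (hK0 : 0 < K) (hK1 : K < 0.276395)
    (h : 2 * (L / (0.3 * L + c)) ≤ K * L - 0.765 + 10 / 3) : False := by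
  have hD : 0 < 0.3 * L + c := by linarith
  have h' : L / (0.3 * L + c) ≤ (K * L - 0.765 + 10 / 3) / 2 := by linarith
  rw [div_le_iff₀ hD] at h'
  have hKL : K * L ≤ 0.276395 * L := mul_le_mul_of_nonneg_right hK1.le (by linarith)
  have hA : 0 < (0.276395 * L - 0.765 + 10 / 3) / 2 := by linarith
  have step1 : (K * L - 0.765 + 10 / 3) / 2 * (0.3 * L + c) ≤
      (0.276395 * L - 0.765 + 10 / 3) / 2 * (0.3 * L + c) :=
    mul_le_mul_of_nonneg_right (by linarith) hD.le
  have step2 : (0.276395 * L - 0.765 + 10 / 3) / 2 * (0.3 * L + c) <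
      (0.276395 * L - 0.765 + 10 / 3) / 2 * (0.3 * L + 0.311) :=
    mul_lt_mul_of_pos_left (by linarith) hA
  have step3 := smallRegime_aux hL1.le hLub.le
  linarith

/-- `1/(2R₁) < 1/R₁`, i.e. `pageConst < landauConst`. [cite: ThornerZaman2024LogFree, Corollary 2.5] -/
theorem pageConst_lt_landauConst : ThornerZaman2024.pageConst < ThornerZaman2024.landauConst := by
  have h := ThornerZaman2024.pageConst_pos
  rw [ThornerZaman2024.pageConst_eq_half_landauConst] at h ⊢
  linarith

/-- **The endgame of McCurley's §3 (26), for one character.** No two reals `β₁, β₂ ∈ [1 − c/L, 1)`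
(`c = 1/R₁`, `L > 1`; `β₁ = β₂` allowed) satisfy
`1/(σ−β₁) + 1/(σ−β₂) − 1/(σ−1) ≤ KM − 0.765` for all `1 < σ ≤ 1.3`, if `M ≤ L`: with
`r = (√2−1)/(2K)`, if `r ≤ 0.3L` take `σ = 1 + r/L` (`key_identity`: the left side is `≥ 2KL`),
else `L < 2.4984` and `σ = 1.3` (`smallRegime_contra`). [cite: McCurley1984ZFR, §3 (26)] -/
private theorem endgame {L M β₁ β₂ : ℝ} (hL1 : 1 < L) (hM : M ≤ L)
    (hb1 : 1 - ThornerZaman2024.landauConst / L ≤ β₁)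
    (hb2 : 1 - ThornerZaman2024.landauConst / L ≤ β₂) (hβ1lt : β₁ < 1) (hβ2lt : β₂ < 1)
    (h : ∀ σ : ℝ, 1 < σ → σ ≤ 1.3 →
      1 / (σ - β₁) + 1 / (σ - β₂) - 1 / (σ - 1) ≤ bigK * M - 0.765) : False := by
  have hLpos : 0 < L := by linarith
  set c : ℝ := ThornerZaman2024.landauConst with hcdef
  have hc0 : 0 < c := ThornerZaman2024.pageConst_pos.trans pageConst_lt_landauConst
  have hc1 : c < 0.311 := landauConst_lt
  have hK := bigK_gt
  have hK' := bigK_lt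
  have hK0 := bigK_pos
  have hKk : bigK * M ≤ bigK * L := mul_le_mul_of_nonneg_left hM hK0.le
  have hKL : 0 < bigK * L := mul_pos hK0 hLpos
  -- McCurley's `r`
  set r : ℝ := (Real.sqrt 2 - 1) / (2 * bigK) with hrdef
  have h2a : (1.41421 : ℝ) < Real.sqrt 2 := by
    rw [show (1.41421 : ℝ) = Real.sqrt (1.41421 ^ 2) by rw [Real.sqrt_sq (by norm_num)]]
    exact Real.sqrt_lt_sqrt (by norm_num) (by norm_num)
  have h2b : Real.sqrt 2 < 1.41422 := by
    rw [show (1.41422 : ℝ) = Real.sqrt (1.41422 ^ 2) by rw [Real.sqrt_sq (by norm_num)]]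
    exact Real.sqrt_lt_sqrt (by norm_num) (by norm_num)
  have hr0 : 0 < r := div_pos (by linarith) (by linarith)
  have hr1 : r ≤ 0.7495 := by
    rw [hrdef, div_le_iff₀ (by linarith)]
    linarith
  by_cases hreg : r ≤ 0.3 * L
  · -- regime `σ = 1 + r/L ≤ 1.3`
    set σ : ℝ := 1 + r / L with hσdef
    have hrL : 0 < r / L := div_pos hr0 hLpos
    have hσ1 : 1 < σ := by linarith
    have hσ13 : σ ≤ 1.3 := by
      have : r / L ≤ 0.3 := by rw [div_le_iff₀ hLpos]; exact hreg
      linarith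
    have hmain := h σ hσ1 hσ13
    -- lower bound `≥ 2KL`
    have hS_ge : 2 * bigK * L ≤ 1 / (σ - β₁) + 1 / (σ - β₂) - 1 / (σ - 1) := by
      have hkey : 2 / (r + c) - 1 / r = 2 * bigK := key_identity
      have hrc : 0 < r + c := by linarith
      have hσβ₁ : 0 < σ - β₁ := by linarith
      have hσβ₂ : 0 < σ - β₂ := by linarith
      have hd₁ : σ - β₁ ≤ (r + c) / L := by
        rw [hσdef, add_div]; linarith
      have hd₂ : σ - β₂ ≤ (r + c) / L := by
        rw [hσdef, add_div]; linarith
      have h1 : L / (r + c) ≤ 1 / (σ - β₁) := by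
        rw [div_le_div_iff₀ hrc hσβ₁, one_mul]
        have := (le_div_iff₀ hLpos).1 hd₁
        linarith
      have h2 : L / (r + c) ≤ 1 / (σ - β₂) := by
        rw [div_le_div_iff₀ hrc hσβ₂, one_mul]
        have := (le_div_iff₀ hLpos).1 hd₂
        linarith
      have h3 : 1 / (σ - 1) = L / r := by
        rw [hσdef, add_sub_cancel_left, one_div_div]
      have e : 2 * (L / (r + c)) - L / r = L * (2 / (r + c) - 1 / r) := by ring
      have e2 : 2 * bigK * L = 2 * (L / (r + c)) - L / r := by rw [e, hkey]; ring
      rw [h3]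
      linarith [h1, h2, e2]
    linarith
  · -- regime `σ = 1.3` (`L < r/0.3 < 2.4984`)
    have hLub : L < 2.4984 := by
      have : 0.3 * L < r := not_le.1 hreg
      linarith
    have hmain := h 1.3 (by norm_num) le_rfl
    have h3 : (1 : ℝ) / (1.3 - 1) = 10 / 3 := by norm_num
    rw [h3] at hmain
    have hD : 0 < 0.3 * L + c := by linarith
    have hσβ₁ : (0 : ℝ) < 1.3 - β₁ := by linarith
    have hσβ₂ : (0 : ℝ) < 1.3 - β₂ := by linarith
    have hcLL : c / L * L = c := div_mul_cancel₀ c hLpos.ne'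
    have hb1L : (1 - c / L) * L ≤ β₁ * L := mul_le_mul_of_nonneg_right hb1 hLpos.le
    have hb2L : (1 - c / L) * L ≤ β₂ * L := mul_le_mul_of_nonneg_right hb2 hLpos.le
    have h1 : L / (0.3 * L + c) ≤ 1 / (1.3 - β₁) := by
      rw [div_le_div_iff₀ hD hσβ₁, one_mul]
      linarith only [hb1L, hcLL]
    have h2 : L / (0.3 * L + c) ≤ 1 / (1.3 - β₂) := by
      rw [div_le_div_iff₀ hD hσβ₂, one_mul]
      linarith only [hb2L, hcLL]
    exact smallRegime_contra hL1 hLub hc0 hc1 hK0 hK' (by linarith only [h1, h2, hmain, hKk])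

/-- The order of `L(s, χ)` equals that of `L(s, χ*)` at every `s` with `Re s > 0` (`χ ≠ 1`; the
Euler factors `1 − χ*(p)p^{−s}` are analytic and non-zero there). This is the tree's
`SuzukiThm6iii.zeroOrder_eq_primitiveCharacter_of_re_pos` (`ChebyshevHalfLineBiasThm6iiiProofs.lean`),
re-proved here verbatim to keep this file's imports small. [cite: DavenportMNT1980, ch. 5 (2)–(3)] -/
private theorem zeroOrder_eq_primitiveCharacter_of_re_pos₂ (χ : DirichletCharacter ℂ q) (hχ : χ ≠ 1)
    {s : ℂ} (hs : 0 < s.re) :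
    haveI : NeZero χ.conductor := ⟨χ.conductor_ne_zero⟩
    DirichletDisc.zeroOrder χ s = DirichletDisc.zeroOrder χ.primitiveCharacter s := by
  haveI : NeZero χ.conductor := ⟨χ.conductor_ne_zero⟩
  set ψ := χ.primitiveCharacter with hψ
  have hψ1 : ψ ≠ 1 := by
    intro h
    apply hχ
    rw [← DirichletCharacter.changeLevel_primitiveCharacter χ, ← hψ, h, map_one]
  set E : ℂ → ℂ := fun s ↦ ∏ p ∈ q.primeFactors, (1 - ψ p * (p : ℂ) ^ (-s)) with hE
  have hfun : χ.LFunction = fun s ↦ ψ.LFunction s * E s := by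
    funext s
    have key := DirichletCharacter.LFunction_changeLevel χ.conductor_dvd_level ψ (s := s) (Or.inl hψ1)
    rw [hψ, DirichletCharacter.changeLevel_primitiveCharacter] at key
    rw [key]
  have hdfac : ∀ s : ℂ, ∀ p ∈ q.primeFactors,
      DifferentiableAt ℂ (fun s : ℂ ↦ 1 - ψ p * (p : ℂ) ^ (-s)) s := by
    intro s p hp
    have hp0 : (p : ℂ) ≠ 0 := by exact_mod_cast (Nat.prime_of_mem_primeFactors hp).ne_zero
    exact ((differentiableAt_id.neg.const_cpow (Or.inl hp0)).const_mul _).const_sub _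
  have hEd : Differentiable ℂ E := fun s ↦ by
    rw [hE]
    exact DifferentiableAt.fun_finsetProd (hdfac s)
  have hEan : AnalyticAt ℂ E s := hEd.analyticAt _
  have hE0 : E s ≠ 0 := by
    rw [hE]
    exact Finset.prod_ne_zero_iff.2 fun p hp ↦
      DirichletCharacter.one_sub_mul_prime_cpow_ne_zero ψ (Nat.prime_of_mem_primeFactors hp) hs
  have hψan : AnalyticAt ℂ ψ.LFunction s :=
    (DirichletCharacter.differentiable_LFunction hψ1).analyticAt _
  have hord : analyticOrderAt χ.LFunction s = analyticOrderAt ψ.LFunction s := by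
    rw [hfun, show (fun s ↦ ψ.LFunction s * E s) = ψ.LFunction * E from rfl,
      analyticOrderAt_mul hψan hEan, hEan.analyticOrderAt_eq_zero.2 hE0, add_zero]
  rw [DirichletDisc.zeroOrder, DirichletDisc.zeroOrder, analyticOrderNatAt, analyticOrderNatAt, hord]

/-- A zero `b` of `L(s, χ)` (`χ ≠ 1`) with `L'(b, χ) = 0` has multiplicity `m_χ(b) ≥ 2`. [folklore] -/
private theorem two_le_zeroOrder_of_deriv_eq_zero {χ : DirichletCharacter ℂ q} (hχ : χ ≠ 1) {b : ℂ}
    (hb : χ.LFunction b = 0) (hb' : deriv χ.LFunction b = 0) : 2 ≤ DirichletDisc.zeroOrder χ b := by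
  have han : AnalyticAt ℂ χ.LFunction b := (DirichletCharacter.differentiable_LFunction hχ).analyticAt b
  have h2 : ((2 : ℕ) : ℕ∞) ≤ analyticOrderAt χ.LFunction b := by
    rw [natCast_le_analyticOrderAt_iff_iteratedDeriv_eq_zero han]
    intro i hi
    interval_cases i
    · simpa using hb
    · simpa [iteratedDeriv_one] using hb'
  have hne := DirichletDisc.analyticOrderAt_LFunction_ne_top χ hχ b
  have hcast : ((DirichletDisc.zeroOrder χ b : ℕ) : ℕ∞) = analyticOrderAt χ.LFunction b := by
    rw [DirichletDisc.zeroOrder, Nat.cast_analyticOrderNatAt hne]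
  rw [← hcast] at h2
  exact_mod_cast h2

/-- **Two real zeros of one real character repel (explicit Page-type bound, DERIVED by McCurley's
method with Stechkin's device; not printed with this constant).** For every `q ≥ 3` and every
quadratic `χ ≠ 1` mod `q` (imprimitive allowed): if `β₁ ≠ β₂` are real zeros of `L(s, χ)` then
`min{β₁, β₂} < 1 − (1/R₁)/log q`, `1/R₁ = (15 − 10√2)/(5 − √5) = landauConst = 0.3103…`.
McCurley's Theorem 1 prints the real-zero clause with `1/R = 1/9.645908801` and `log max{q,10}`;
his §3 (the proof of Theorem 2) gives the present constant for one character. Proof: reduce to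
the primitive character (conductor `k ≤ q`, same real zeros in `(0,1)`); if both
`β_i ≥ 1 − c/L` (`c = 1/R₁ < 0.311`, `L = log q > 1`, so `β_i > ½`), `main_inequality_single`
feeds `endgame`. [cite: McCurley1984ZFR, Theorem 1 (real-zero clause, p. 8); §3 (23)–(26)] -/
theorem twoRealZeros_lt_landauWindow :
    ∀ (q : ℕ) [NeZero q], 3 ≤ q → ∀ χ : DirichletCharacter ℂ q, χ.IsQuadratic → χ ≠ 1 →
      ∀ β₁ β₂ : ℝ, β₁ ≠ β₂ → χ.LFunction β₁ = 0 → χ.LFunction β₂ = 0 →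
        min β₁ β₂ < 1 - ThornerZaman2024.landauConst / Real.log q := by
  intro q _ hq χ hquad h1 β₁ β₂ hne hz1 hz2
  set L : ℝ := Real.log q with hLdef
  have hq3 : (3 : ℝ) ≤ q := by exact_mod_cast hq
  have hL1 : 1 < L := by
    rw [hLdef, Real.lt_log_iff_exp_lt (by linarith)]
    have := Real.exp_one_lt_d9
    linarith
  have hLpos : 0 < L := by linarith
  have hc1 : ThornerZaman2024.landauConst < 0.311 := landauConst_lt
  by_contra hcon
  obtain ⟨hb1, hb2⟩ := le_min_iff.1 (not_lt.1 hcon)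
  have hcL : ThornerZaman2024.landauConst / L < 0.311 := by
    rw [div_lt_iff₀ hLpos]
    nlinarith
  have hβ1 : 0.689 < β₁ := by linarith
  have hβ2 : 0.689 < β₂ := by linarith
  -- real zeros are `< 1`
  have hlt1 : ∀ β : ℝ, χ.LFunction β = 0 → β < 1 := by
    intro β hz
    by_contra hb
    exact LFunction_ne_zero_of_one_le_re χ (Or.inl h1) (by simpa using not_lt.1 hb) hz
  have hβ1lt := hlt1 β₁ hz1
  have hβ2lt := hlt1 β₂ hz2
  -- pass to the primitive character `ψ` of conductor `k ≤ q`
  haveI : NeZero χ.conductor := ⟨χ.conductor_ne_zero⟩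
  set ψ := χ.primitiveCharacter with hψdef
  have hzψ : ∀ β : ℝ, 0 < β → β < 1 → χ.LFunction β = 0 → ψ.LFunction β = 0 := by
    intro β hβ0 hβ1' hz
    have hne1 : (β : ℂ) ≠ 1 := by
      intro h
      have h' := congrArg Complex.re h
      simp only [ofReal_re, one_re] at h'
      linarith
    exact (χ.LFunction_eq_zero_iff_primitiveCharacter (s := β) (by simpa using hβ0) hne1).1 hz
  have hzψ1 := hzψ β₁ (by linarith) hβ1lt hz1
  have hzψ2 := hzψ β₂ (by linarith) hβ2lt hz2
  have hψp : ψ.IsPrimitive := primitiveCharacter_isPrimitive χ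
  have hψq : ψ.IsQuadratic := primitiveCharacter_isQuadratic₂ hquad
  obtain ⟨hψ1, -⟩ := ne_one_and_lt_one hψp (show (0 : ℝ) < β₁ by linarith) hzψ1
  have hkq : (χ.conductor : ℝ) ≤ q := by
    exact_mod_cast Nat.le_of_dvd (Nat.pos_of_ne_zero (NeZero.ne q)) χ.conductor_dvd_level
  have hkpos : (0 : ℝ) < χ.conductor := by
    exact_mod_cast Nat.pos_of_ne_zero χ.conductor_ne_zero
  have hlogk : Real.log (χ.conductor : ℝ) ≤ L := Real.log_le_log hkpos hkq
  exact endgame hL1 hlogk hb1 hb2 hβ1lt hβ2lt fun σ hσ hσ' ↦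
    main_inequality_single hψp hψq hψ1 (by linarith) hβ1lt.le hzψ1 (by linarith) hβ2lt.le hzψ2
      hne hσ hσ'

/-- **A real zero in the Landau window is SIMPLE (DERIVED, same method).** For every `q ≥ 3` and
every quadratic `χ ≠ 1` mod `q` (imprimitive allowed): a real zero `β ≥ 1 − (1/R₁)/log q` of
`L(s, χ)` has `L'(β, χ) ≠ 0`, i.e. multiplicity one. (McCurley's Theorem 1: "The only possible zero
in this region is a simple real zero"; Thorner–Zaman's Corollary 2.5 / Theorem 2.6: "`β₁(Q)` is a
simple zero" — the clause the tree's named facts do not render.) Proof: a double zero passes to the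
primitive character with multiplicity `≥ 2` (`Re β > 0`), `main_inequality_double` feeds `endgame`
with `β₁ = β₂ = β`.
[cite: McCurley1984ZFR, Theorem 1 (real-zero clause, p. 8); §3 (23)–(26)]
[cite: ThornerZaman2024LogFree, Corollary 2.5] -/
theorem deriv_ne_zero_of_realZero_landauWindow {q : ℕ} [NeZero q] (hq : 3 ≤ q)
    (χ : DirichletCharacter ℂ q) (hquad : χ.IsQuadratic) (h1 : χ ≠ 1) {β : ℝ}
    (hz : χ.LFunction β = 0) (hβ : 1 - ThornerZaman2024.landauConst / Real.log q ≤ β) :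
    deriv χ.LFunction β ≠ 0 := by
  intro hd
  set L : ℝ := Real.log q with hLdef
  have hq3 : (3 : ℝ) ≤ q := by exact_mod_cast hq
  have hL1 : 1 < L := by
    rw [hLdef, Real.lt_log_iff_exp_lt (by linarith)]
    have := Real.exp_one_lt_d9
    linarith
  have hLpos : 0 < L := by linarith
  have hc1 : ThornerZaman2024.landauConst < 0.311 := landauConst_lt
  have hcL : ThornerZaman2024.landauConst / L < 0.311 := by
    rw [div_lt_iff₀ hLpos]
    nlinarith
  have hβhalf : 0.689 < β := by linarith
  have hβlt : β < 1 := by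
    by_contra hb
    exact LFunction_ne_zero_of_one_le_re χ (Or.inl h1) (by simpa using not_lt.1 hb) hz
  -- multiplicity `≥ 2`, for `χ` and for the primitive character `ψ`
  have hm : 2 ≤ DirichletDisc.zeroOrder χ β := two_le_zeroOrder_of_deriv_eq_zero h1 hz hd
  haveI : NeZero χ.conductor := ⟨χ.conductor_ne_zero⟩
  set ψ := χ.primitiveCharacter with hψdef
  have hmψ : 2 ≤ DirichletDisc.zeroOrder ψ β := by
    have h := zeroOrder_eq_primitiveCharacter_of_re_pos₂ χ h1 (s := β) (by simpa using (by linarith : 0 < β))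
    rw [← hψdef] at h
    rw [← h]
    exact hm
  have hψp : ψ.IsPrimitive := primitiveCharacter_isPrimitive χ
  have hψq : ψ.IsQuadratic := primitiveCharacter_isQuadratic₂ hquad
  have hψ1 : ψ ≠ 1 := by
    intro h
    apply h1
    rw [← changeLevel_primitiveCharacter χ, ← hψdef, h, changeLevel_one]
  have hkq : (χ.conductor : ℝ) ≤ q := by
    exact_mod_cast Nat.le_of_dvd (Nat.pos_of_ne_zero (NeZero.ne q)) χ.conductor_dvd_level
  have hkpos : (0 : ℝ) < χ.conductor := by
    exact_mod_cast Nat.pos_of_ne_zero χ.conductor_ne_zero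
  have hlogk : Real.log (χ.conductor : ℝ) ≤ L := Real.log_le_log hkpos hkq
  exact endgame hL1 hlogk hβ hβ hβlt hβlt fun σ hσ hσ' ↦
    main_inequality_double hψp hψq hψ1 (by linarith) hβlt.le hmψ hσ hσ'

/-- **The binder shape of `ExplicitLandauPageFamilyProofs.lean`** (`hPage` of
`thornerZaman2024_corollary25_of_lemma24_platt_singlePage`) for any constant `c₁ ≤ 1/R₁`:
for `q ≥ 3`, `χ` quadratic `≠ 1` mod `q`, real zeros `β ≠ β'`: `min{β,β'} ≤ 1 − c₁/log q`.
[cite: McCurley1984ZFR, Theorem 1 (real-zero clause); §3] -/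
theorem singlePage_of_le_landauConst {c₁ : ℝ} (hc : c₁ ≤ ThornerZaman2024.landauConst) :
    ∀ (q : ℕ) [NeZero q], 3 ≤ q → ∀ χ : DirichletCharacter ℂ q, χ.IsQuadratic → χ ≠ 1 →
      ∀ β β' : ℝ, β ≠ β' → χ.LFunction β = 0 → χ.LFunction β' = 0 →
        min β β' ≤ 1 - c₁ / Real.log q := by
  intro q _ hq χ hquad hne β β' hββ' hz hz'
  have h := twoRealZeros_lt_landauWindow q hq χ hquad hne β β' hββ' hz hz'
  have hq3 : (3 : ℝ) ≤ q := by exact_mod_cast hq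
  have hlog : 0 < Real.log q := Real.log_pos (by linarith)
  have hmono : c₁ / Real.log q ≤ ThornerZaman2024.landauConst / Real.log q :=
    div_le_div_of_nonneg_right hc hlog.le
  linarith

/-- **"At most one real zero in `[1 − (1/R₁)/log q, 1)`"**: two real zeros of `L(s, χ)` (`χ`
quadratic `≠ 1` mod `q ≥ 3`) both `≥ 1 − landauConst/log q` coincide.
[cite: McCurley1984ZFR, Theorem 1 (real-zero clause); §3] -/
theorem atMostOne_realZero_landauWindow {q : ℕ} [NeZero q] (hq : 3 ≤ q)
    (χ : DirichletCharacter ℂ q) (hquad : χ.IsQuadratic) (hne : χ ≠ 1) {β₁ β₂ : ℝ}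
    (h₁ : 1 - ThornerZaman2024.landauConst / Real.log q ≤ β₁)
    (h₂ : 1 - ThornerZaman2024.landauConst / Real.log q ≤ β₂)
    (hz₁ : χ.LFunction β₁ = 0) (hz₂ : χ.LFunction β₂ = 0) : β₁ = β₂ := by
  by_contra hne'
  have hmin := twoRealZeros_lt_landauWindow q hq χ hquad hne β₁ β₂ hne' hz₁ hz₂
  have : 1 - ThornerZaman2024.landauConst / Real.log q ≤ min β₁ β₂ := le_min h₁ h₂
  linarith

end McCurleyStechkin

open McCurleyStechkin in
/-- **Thorner–Zaman 2024, Corollary 2.5 — from Platt's computation alone.** "Let `Q ≥ 3`. The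
product `𝓜(s,Q) = ∏_{q ≤ Q} ∏_{χ mod q primitive quadratic} L(s,χ)` has at most one real zero in
`s ≥ 1 − (15 − 10√2)/(2(5 − √5) log Q)`; if it exists then `Q > 400 000` and it comes from a
primitive quadratic `χ₁ mod q₁`, `q₁ ∈ (400 000, Q]`" (the named fact
`thornerZaman2024_corollary25`, simplicity not rendered), DERIVED from Platt 2016, Theorems 7.1–7.2
(`platt2016_theorem71/72`, named facts: no real zeros for primitive `χ` mod `q ≤ 400 000`) by the
tree's `thornerZaman2024_corollary25_of_lemma24_platt_singlePage`, with Lemma 2.4 supplied by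
`McCurley1984_theorem2_holds` and the same-character clause by `singlePage_of_le_landauConst`
(`pageConst = 1/(2R₁) < 1/R₁`). [cite: ThornerZaman2024LogFree, Corollary 2.5]
[cite: Platt2016GRH, Theorems 7.1 and 7.2] [cite: McCurley1984ZFR, Theorems 1–2, §3] -/
theorem thornerZaman2024_corollary25_of_platt (h71 : platt2016_theorem71)
    (h72 : platt2016_theorem72) : thornerZaman2024_corollary25 :=
  thornerZaman2024_corollary25_of_lemma24_platt_singlePage
    (thornerZaman2024_lemma24_of_mccurley2 McCurley1984_theorem2_holds) h71 h72
    pageConst_lt_landauConst (singlePage_of_le_landauConst le_rfl)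

/-- **Thorner–Zaman 2024, Theorem 2.6, first assertion (`thornerZaman2024_theorem26a`) from
McCurley's Theorem 1 as printed (closed region, named fact `McCurley1984_theorem1_closed`), Platt
2016 Theorems 7.1–7.2, the two `ζ` facts of the source's Lemma 2.1 (`platt_trudgian_numerical_rh`,
`zero_free_region_mossinghoff_trudgian_yang`)** — the tree's
`thornerZaman2024_theorem26a_of_mccurleyClosed_platt_lemma24` with its Lemma 2.4 hypothesis
discharged by `McCurley1984_theorem2_holds`.
[cite: ThornerZaman2024LogFree, Theorem 2.6 (first assertion)] [cite: McCurley1984ZFR, Theorems 1–2] -/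
theorem thornerZaman2024_theorem26a_of_mccurleyClosed_platt_rh (hM : McCurley1984_theorem1_closed)
    (h71 : platt2016_theorem71) (h72 : platt2016_theorem72) (hRH : platt_trudgian_numerical_rh)
    (hZ : zero_free_region_mossinghoff_trudgian_yang) : thornerZaman2024_theorem26a :=
  thornerZaman2024_theorem26a_of_mccurleyClosed_platt_lemma24 hM h71 h72 hRH hZ
    (thornerZaman2024_lemma24_of_mccurley2 McCurley1984_theorem2_holds)

open McCurleyStechkin ThornerZaman2024 in
/-- **Thorner–Zaman 2024, Corollary 2.5, the simplicity clause — from Platt's computation.** "If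
such a real zero, say `β₁(Q)`, exists, then … `β₁(Q)` is a simple zero of `𝓜(s,Q)`": for `Q ≥ 3`,
a primitive quadratic `χ mod q`, `q ≤ Q`, and a real zero `β ≥ 1 − pageConst/log Q` of `L(s,χ)`,
`L'(β, χ) ≠ 0` (by Corollary 2.5 itself, `thornerZaman2024_corollary25_of_platt`, no other
`L(s, χ')` of the product vanishes at `β`, so `β` is a simple zero of `𝓜(s,Q)`). Platt gives
`q > 400 000 ≥ 3` (`thornerZaman2024_corollary25_level_of_platt`), and the Page window at `Q` lies
inside the Landau window at `q ≤ Q` (`pageConst = landauConst/2`), so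
`deriv_ne_zero_of_realZero_landauWindow` applies. [cite: ThornerZaman2024LogFree, Corollary 2.5]
[cite: Platt2016GRH, Theorems 7.1 and 7.2] -/
theorem thornerZaman2024_corollary25_simple_of_platt (h71 : platt2016_theorem71)
    (h72 : platt2016_theorem72) :
    ∀ Q : ℝ, 3 ≤ Q → ∀ (q : ℕ) [NeZero q] (χ : DirichletCharacter ℂ q), (q : ℝ) ≤ Q →
      χ.IsPrimitive → χ.IsQuadratic → ∀ β : ℝ, χ.LFunction β = 0 →
        1 - pageConst / Real.log Q ≤ β → deriv χ.LFunction β ≠ 0 := by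
  intro Q hQ3 q _ χ hqQ hprim hquad β hz hβ
  have hq4 : 400000 < q := thornerZaman2024_corollary25_level_of_platt h71 h72 hQ3 χ hprim hz hβ
  have hq3 : 3 ≤ q := by omega
  have hq3' : (3 : ℝ) ≤ q := by exact_mod_cast hq3
  have hlogq : 0 < Real.log q := Real.log_pos (by linarith)
  have hlogQ : Real.log q ≤ Real.log Q := Real.log_le_log (by linarith) hqQ
  have hpc0 := pageConst_pos
  have hpl := pageConst_lt_landauConst
  have hw : pageConst / Real.log Q ≤ landauConst / Real.log q :=
    calc pageConst / Real.log Q ≤ pageConst / Real.log q :=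
          div_le_div_of_nonneg_left hpc0.le hlogq hlogQ
      _ ≤ landauConst / Real.log q := div_le_div_of_nonneg_right hpl.le hlogq.le
  have hβpos : 0 < β := by
    have hlogQ1 : 1 < Real.log Q := by
      rw [Real.lt_log_iff_exp_lt (by linarith)]
      have := Real.exp_one_lt_d9
      linarith
    have : pageConst / Real.log Q < 1 / 5 := by
      rw [div_lt_iff₀ (by linarith)]
      have := pageConst_lt_one_fifth
      nlinarith
    linarith
  obtain ⟨h1, -⟩ := ne_one_and_lt_one hprim hβpos hz
  exact deriv_ne_zero_of_realZero_landauWindow hq3 χ hquad h1 hz (by linarith)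

namespace McCurleyStechkin

/-- A non-principal Dirichlet character has modulus `≥ 3` (every character mod `1` or mod `2` is
principal). [folklore] -/
private theorem three_le_of_ne_one {n : ℕ} [NeZero n] {χ : DirichletCharacter ℂ n} (h1 : χ ≠ 1) :
    3 ≤ n := by
  by_contra hlt
  have hn : n = 1 ∨ n = 2 := by have := NeZero.ne n; omega
  rcases hn with rfl | rfl
  · exact h1 (DirichletCharacter.level_one χ)
  · exact h1 (MulChar.ext fun u ↦ by rw [Subsingleton.elim u 1]; simp)

/-- The non-principal character mod `3` is unique (its value at `2 ≡ −1` is `−1`). [folklore] -/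
private theorem eq_of_ne_one_level_three {χ χ' : DirichletCharacter ℂ 3} (h1 : χ ≠ 1)
    (h1' : χ' ≠ 1) : χ = χ' := by
  have hcases : ∀ x : ZMod 3, x = 0 ∨ x = 1 ∨ x = 2 := by decide
  have h2u : IsUnit (2 : ZMod 3) := ⟨⟨2, 2, by decide, by decide⟩, rfl⟩
  have hval : ∀ ψ : DirichletCharacter ℂ 3, ψ ≠ 1 → ψ 2 = -1 := by
    intro ψ hψ
    have hsq : ψ 2 * ψ 2 = 1 := by
      rw [← map_mul, show (2 : ZMod 3) * 2 = 1 by decide, map_one]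
    rcases mul_self_eq_one_iff.1 hsq with h | h
    · exfalso
      apply hψ
      refine MulChar.ext fun u ↦ ?_
      rcases hcases u with hu | hu | hu
      · exact absurd hu u.ne_zero
      · rw [hu, map_one, map_one]
      · rw [hu, h, MulChar.one_apply h2u]
    · exact h
  refine MulChar.ext fun u ↦ ?_
  rcases hcases u with hu | hu | hu
  · exact absurd hu u.ne_zero
  · rw [hu, map_one, map_one]
  · rw [hu, hval χ h1, hval χ' h1']

end McCurleyStechkin

open McCurleyStechkin ThornerZaman2024 in
/-- **Thorner–Zaman 2024, Corollary 2.5, first clause — UNCONDITIONAL (no Platt, no named fact).**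
"Let `Q ≥ 3`. The product `𝓜(s,Q) = ∏_{q ≤ Q} ∏_{χ mod q primitive quadratic} L(s,χ)` has at most
one real zero in the interval `s ≥ 1 − (15 − 10√2)/(2(5 − √5) log Q)`", rendered as in the named
fact `thornerZaman2024_corollary25` (first conjunct): two triples (modulus `≤ Q`, primitive
quadratic character, real zero in the window) coincide. PROVED outright: distinct characters —
McCurley's Theorem 2 (`McCurley1984_theorem2_holds`) with `M₁ = max{qq'/17, 13} ≤ Q²` when
`Q² ≥ 13` (so `1/(R₁ log M₁) ≥ pageConst/log Q`), while for `Q² < 13` both moduli are `3` and the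
non-principal character mod `3` is unique; same character — `atMostOne_realZero_landauWindow`
(`pageConst/log Q ≤ landauConst/log q`). The printed proof uses Platt's computation at this point
only to invoke Lemma 2.4 in its `min{q,q'} > 400 000` form; McCurley's theorem has no threshold.
The second clause (`q > 400 000`) is Platt's computation itself (`thornerZaman2024_corollary25_of_platt`).
[cite: ThornerZaman2024LogFree, Corollary 2.5] [cite: McCurley1984ZFR, Theorems 1–2, §3] -/
theorem thornerZaman2024_corollary25_first :
    ∀ Q : ℝ, 3 ≤ Q →
    ∀ (q q' : ℕ) [NeZero q] [NeZero q'] (χ : DirichletCharacter ℂ q) (χ' : DirichletCharacter ℂ q'),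
      (q : ℝ) ≤ Q → (q' : ℝ) ≤ Q → χ.IsPrimitive → χ.IsQuadratic → χ'.IsPrimitive → χ'.IsQuadratic →
        ∀ β β' : ℝ, χ.LFunction β = 0 → χ'.LFunction β' = 0 →
          1 - pageConst / Real.log Q ≤ β → 1 - pageConst / Real.log Q ≤ β' →
            β = β' ∧ ∃ h : q = q', h ▸ χ = χ' := by
  intro Q hQ3 q q' _ _ χ χ' hqQ hq'Q hp hquad hp' hquad' β β' hz hz' hβ hβ'
  have hlogQ : 1 < Real.log Q := by
    rw [Real.lt_log_iff_exp_lt (by linarith)]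
    have := Real.exp_one_lt_d9
    linarith
  have hpc0 := pageConst_pos
  have hpl := pageConst_lt_landauConst
  have hwin : pageConst / Real.log Q < 1 / 5 := by
    rw [div_lt_iff₀ (by linarith)]
    have := pageConst_lt_one_fifth
    nlinarith
  obtain ⟨h1, -⟩ := ne_one_and_lt_one hp (show (0 : ℝ) < β by linarith) hz
  obtain ⟨h1', -⟩ := ne_one_and_lt_one hp' (show (0 : ℝ) < β' by linarith) hz'
  have hq3 : 3 ≤ q := three_le_of_ne_one h1
  have hq3' : 3 ≤ q' := three_le_of_ne_one h1'
  have hmin : 1 - pageConst / Real.log Q ≤ min β β' := le_min hβ hβ'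
  by_cases hdist : q ≠ q' ∨ ∃ h : q = q', h ▸ χ ≠ χ'
  · -- distinct characters: McCurley's Theorem 2
    exfalso
    have hM := McCurley1984_theorem2_holds q q' χ χ' hp hquad hp' hquad' hdist β β' hz hz'
    rw [ThornerZaman2024.one_div_rOne_mul_eq] at hM
    by_cases hQ13 : 13 ≤ Q ^ 2
    · have hqq : (q : ℝ) * q' / 17 ≤ Q ^ 2 := by
        rw [div_le_iff₀ (by norm_num)]
        have hq0 : (0 : ℝ) ≤ q := Nat.cast_nonneg q
        have hq0' : (0 : ℝ) ≤ q' := Nat.cast_nonneg q'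
        have : (q : ℝ) * q' ≤ Q * Q := mul_le_mul hqQ hq'Q hq0' (by linarith)
        nlinarith
      have hMQ : max ((q : ℝ) * q' / 17) 13 ≤ Q ^ 2 := max_le hqq hQ13
      have hM1 : (1 : ℝ) < max ((q : ℝ) * q' / 17) 13 :=
        lt_of_lt_of_le (by norm_num) (le_max_right _ _)
      have hlogM0 : 0 < Real.log (max ((q : ℝ) * q' / 17) 13) := Real.log_pos hM1
      have hlogM : Real.log (max ((q : ℝ) * q' / 17) 13) ≤ 2 * Real.log Q := by
        have e : Real.log (Q ^ 2) = 2 * Real.log Q := by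
          rw [Real.log_pow]; norm_num
        rw [← e]
        exact Real.log_le_log (by linarith) hMQ
      have hcmp : pageConst / Real.log Q ≤ landauConst / Real.log (max ((q : ℝ) * q' / 17) 13) := by
        rw [pageConst_eq_half_landauConst, div_div]
        exact div_le_div_of_nonneg_left (by linarith) hlogM0 hlogM
      linarith
    · -- `Q² < 13`: both moduli are `3`, and the non-principal character mod `3` is unique
      have hQ : Q < 3.7 := by nlinarith
      have hq4 : q < 4 := by exact_mod_cast (show (q : ℝ) < 4 by linarith)
      have hq4' : q' < 4 := by exact_mod_cast (show (q' : ℝ) < 4 by linarith)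
      obtain rfl : q = 3 := by omega
      obtain rfl : q' = 3 := by omega
      rcases hdist with h | ⟨h, hne⟩
      · exact h rfl
      · exact hne (eq_of_ne_one_level_three h1 h1')
  · -- the same character: `atMostOne_realZero_landauWindow`
    have hqq : q = q' := by
      by_contra h
      exact hdist (Or.inl h)
    subst hqq
    have hχχ : χ = χ' := by
      by_contra h
      exact hdist (Or.inr ⟨rfl, h⟩)
    subst hχχ
    refine ⟨?_, rfl, rfl⟩
    have hq3R : (3 : ℝ) ≤ q := by exact_mod_cast hq3
    have hlogq : 0 < Real.log q := Real.log_pos (by linarith)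
    have hlogqQ : Real.log q ≤ Real.log Q := Real.log_le_log (by linarith) hqQ
    have hw : pageConst / Real.log Q ≤ landauConst / Real.log q :=
      calc pageConst / Real.log Q ≤ pageConst / Real.log q :=
            div_le_div_of_nonneg_left hpc0.le hlogq hlogqQ
        _ ≤ landauConst / Real.log q := div_le_div_of_nonneg_right hpl.le hlogq.le
    exact atMostOne_realZero_landauWindow hq3 χ hquad h1 (by linarith) (by linarith) hz hz'

namespace McCurleyStechkin

open DirichletCharacter

/-- Distinct induced characters come from distinct primitive data (the shape of the hypothesis of
`McCurley1984_theorem2`). [folklore] -/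
private theorem ne_or_of_changeLevel_ne {k d₁ d₂ : ℕ} {ψ₁ : DirichletCharacter ℂ d₁}
    {ψ₂ : DirichletCharacter ℂ d₂} (h₁ : d₁ ∣ k) (h₂ : d₂ ∣ k)
    (hne : changeLevel h₁ ψ₁ ≠ changeLevel h₂ ψ₂) : d₁ ≠ d₂ ∨ ∃ h : d₁ = d₂, h ▸ ψ₁ ≠ ψ₂ := by
  by_cases hd : d₁ = d₂
  · subst hd
    refine Or.inr ⟨rfl, fun he ↦ hne ?_⟩
    rw [show ψ₁ = ψ₂ from he]
  · exact Or.inl hd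

/-- **The real-character part of the real-zero clause of McCurley's Theorem 1, with the constant of
Theorem 2 (DERIVED; not printed in this form).** For every modulus `k ≥ 3`: if `χ, χ'` are
quadratic non-principal characters mod `k` (imprimitive allowed) with real zeros
`β, β' ≥ 1 − (1/(2R₁))/log k` (`1/(2R₁) = pageConst = 0.155…`), then `β = β'` and `χ = χ'` — among
the real characters mod `k` at most one `L(s, χ)` has a real zero in this window, and only one
zero (simple, by `deriv_ne_zero_of_realZero_landauWindow`). McCurley prints, for ALL characters mod
`k`, "at most a single zero in `σ ≥ 1 − 1/(R log max{k, k|t|, 10})`, `R = 9.645908801` … a simple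
real zero arising from … a real non-principal character"; here only real characters and real zeros
are treated, with `0.155…/log k` in place of `0.1036…/log max{k,10}`. Proof: different characters
are induced by distinct primitive quadratic characters of conductors `d, d' ∣ k`, so Theorem 2
(`McCurley1984_theorem2_holds`) applies with `M₁ = max{dd'/17, 13} ≤ k²` (`k ≥ 4`; mod `3` there
is one non-principal character); equal characters: `atMostOne_realZero_landauWindow`.
[cite: McCurley1984ZFR, Theorem 1 (real-zero clause, p. 8) and Theorem 2] -/
theorem realZeros_quadratic_sameModulus {k : ℕ} [NeZero k] (hk : 3 ≤ k)
    (χ χ' : DirichletCharacter ℂ k) (hq : χ.IsQuadratic) (h1 : χ ≠ 1) (hq' : χ'.IsQuadratic)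
    (h1' : χ' ≠ 1) {β β' : ℝ} (hz : χ.LFunction β = 0) (hz' : χ'.LFunction β' = 0)
    (hβ : 1 - ThornerZaman2024.pageConst / Real.log k ≤ β)
    (hβ' : 1 - ThornerZaman2024.pageConst / Real.log k ≤ β') : β = β' ∧ χ = χ' := by
  have hk3 : (3 : ℝ) ≤ k := by exact_mod_cast hk
  have hlogk : 1 < Real.log k := by
    rw [Real.lt_log_iff_exp_lt (by linarith)]
    have := Real.exp_one_lt_d9
    linarith
  have hlogk0 : 0 < Real.log k := by linarith
  have hpc0 := ThornerZaman2024.pageConst_pos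
  have hpl := pageConst_lt_landauConst
  have hwin : ThornerZaman2024.pageConst / Real.log k < 1 / 5 := by
    rw [div_lt_iff₀ hlogk0]
    have := ThornerZaman2024.pageConst_lt_one_fifth
    nlinarith
  have hβ0 : 0.8 < β := by linarith
  have hβ'0 : 0.8 < β' := by linarith
  have hw : ThornerZaman2024.pageConst / Real.log k ≤ ThornerZaman2024.landauConst / Real.log k :=
    div_le_div_of_nonneg_right hpl.le hlogk0.le
  by_cases hχχ : χ = χ'
  · subst hχχ
    exact ⟨atMostOne_realZero_landauWindow hk χ hq h1 (by linarith) (by linarith) hz hz', rfl⟩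
  exfalso
  rcases (show k = 3 ∨ 4 ≤ k by omega) with rfl | hk4
  · exact hχχ (eq_of_ne_one_level_three h1 h1')
  -- `k ≥ 4`: pass to the primitive characters and apply McCurley's Theorem 2
  have hlt1 : ∀ {ψ : DirichletCharacter ℂ k}, ψ ≠ 1 → ∀ {b : ℝ}, ψ.LFunction b = 0 → b < 1 := by
    intro ψ hψ b hb
    by_contra hh
    exact LFunction_ne_zero_of_one_le_re ψ (Or.inl hψ) (by simpa using not_lt.1 hh) hb
  have hβ1 := hlt1 h1 hz
  have hβ'1 := hlt1 h1' hz'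
  haveI : NeZero χ.conductor := ⟨χ.conductor_ne_zero⟩
  haveI : NeZero χ'.conductor := ⟨χ'.conductor_ne_zero⟩
  set ψ := χ.primitiveCharacter with hψdef
  set ψ' := χ'.primitiveCharacter with hψ'def
  have hzψ : ψ.LFunction β = 0 := by
    have hne1 : (β : ℂ) ≠ 1 := by
      intro h
      have h' := congrArg Complex.re h
      simp only [ofReal_re, one_re] at h'
      linarith
    exact (χ.LFunction_eq_zero_iff_primitiveCharacter (s := β)
      (by simpa using (by linarith : (0 : ℝ) < β)) hne1).1 hz
  have hzψ' : ψ'.LFunction β' = 0 := by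
    have hne1 : (β' : ℂ) ≠ 1 := by
      intro h
      have h' := congrArg Complex.re h
      simp only [ofReal_re, one_re] at h'
      linarith
    exact (χ'.LFunction_eq_zero_iff_primitiveCharacter (s := β')
      (by simpa using (by linarith : (0 : ℝ) < β')) hne1).1 hz'
  have hψp : ψ.IsPrimitive := primitiveCharacter_isPrimitive χ
  have hψ'p : ψ'.IsPrimitive := primitiveCharacter_isPrimitive χ'
  have hψq : ψ.IsQuadratic := primitiveCharacter_isQuadratic₂ hq
  have hψ'q : ψ'.IsQuadratic := primitiveCharacter_isQuadratic₂ hq'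
  have hind : changeLevel χ.conductor_dvd_level ψ = χ := changeLevel_primitiveCharacter χ
  have hind' : changeLevel χ'.conductor_dvd_level ψ' = χ' := changeLevel_primitiveCharacter χ'
  have hdist : χ.conductor ≠ χ'.conductor ∨ ∃ h : χ.conductor = χ'.conductor, h ▸ ψ ≠ ψ' := by
    refine ne_or_of_changeLevel_ne χ.conductor_dvd_level χ'.conductor_dvd_level ?_
    rw [hind, hind']
    exact hχχ
  have hM := McCurley1984_theorem2_holds _ _ ψ ψ' hψp hψq hψ'p hψ'q hdist β β' hzψ hzψ'
  rw [ThornerZaman2024.one_div_rOne_mul_eq] at hM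
  -- `dd'/17 ≤ k²` and `13 ≤ k²`
  have hd : (χ.conductor : ℝ) ≤ k := by
    exact_mod_cast Nat.le_of_dvd (Nat.pos_of_ne_zero (NeZero.ne k)) χ.conductor_dvd_level
  have hd' : (χ'.conductor : ℝ) ≤ k := by
    exact_mod_cast Nat.le_of_dvd (Nat.pos_of_ne_zero (NeZero.ne k)) χ'.conductor_dvd_level
  have hk4R : (4 : ℝ) ≤ k := by exact_mod_cast hk4
  have h13 : (13 : ℝ) ≤ (k : ℝ) ^ 2 := by nlinarith
  have hdd : (χ.conductor : ℝ) * χ'.conductor / 17 ≤ (k : ℝ) ^ 2 := by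
    rw [div_le_iff₀ (by norm_num)]
    have h0' : (0 : ℝ) ≤ χ'.conductor := Nat.cast_nonneg _
    have : (χ.conductor : ℝ) * χ'.conductor ≤ k * k := mul_le_mul hd hd' h0' (by linarith)
    nlinarith
  have hMk : max ((χ.conductor : ℝ) * χ'.conductor / 17) 13 ≤ (k : ℝ) ^ 2 := max_le hdd h13
  have hM1 : (1 : ℝ) < max ((χ.conductor : ℝ) * χ'.conductor / 17) 13 :=
    lt_of_lt_of_le (by norm_num) (le_max_right _ _)
  have hlogM0 : 0 < Real.log (max ((χ.conductor : ℝ) * χ'.conductor / 17) 13) := Real.log_pos hM1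
  have hlogM : Real.log (max ((χ.conductor : ℝ) * χ'.conductor / 17) 13) ≤ 2 * Real.log k := by
    have e : Real.log ((k : ℝ) ^ 2) = 2 * Real.log k := by
      rw [Real.log_pow]; norm_num
    rw [← e]
    exact Real.log_le_log (by linarith) hMk
  have hcmp : ThornerZaman2024.pageConst / Real.log k ≤
      ThornerZaman2024.landauConst / Real.log (max ((χ.conductor : ℝ) * χ'.conductor / 17) 13) := by
    rw [ThornerZaman2024.pageConst_eq_half_landauConst, div_div]
    exact div_le_div_of_nonneg_left (by linarith) hlogM0 hlogM
  have hmin : 1 - ThornerZaman2024.pageConst / Real.log k ≤ min β β' := le_min hβ hβ'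
  linarith

end McCurleyStechkin

/-! ## The exceptional zero of McCurley's Theorem 1 / Thorner–Zaman's Theorem 2.6 is simple -/

namespace McCurleyStechkin

open ThornerZaman2024

/-- **McCurley's exceptional zero is SIMPLE — the clause "a simple real zero" of Theorem 1, which the
named facts `McCurley1984_theorem1{,_closed}` do not render, PROVED modulo the fact.** If
`McCurley1984_theorem1_closed` holds, then for `q ≥ 3`, any `χ mod q` and any zero `s ≠ 1` of
`L(s, χ)` in the closed region `Re s ≥ 1 − 1/(R log max{q, q|Im s|, 10})`, `R = 9.645908801`, one
has `L'(s, χ) ≠ 0`: the fact makes `s` real and `χ` quadratic non-principal, the region lies inside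
the Landau window (`1/(R log max{q,…,10}) ≤ zfrConst/log q ≤ landauConst/log q`), and
`deriv_ne_zero_of_realZero_landauWindow` applies. [cite: McCurley1984ZFR, Theorem 1 (p. 8)] -/
theorem deriv_ne_zero_of_mccurleyClosed (hM : McCurley1984_theorem1_closed) {q : ℕ} [NeZero q]
    (hq : 3 ≤ q) (χ : DirichletCharacter ℂ q) {s : ℂ} (hs1 : s ≠ 1)
    (hreg : 1 - 1 / (9.645908801 * Real.log (max (max (q : ℝ) ((q : ℝ) * |s.im|)) 10)) ≤ s.re)
    (hz : χ.LFunction s = 0) : deriv χ.LFunction s ≠ 0 := by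
  obtain ⟨-, him, h1, hsq⟩ := hM q hq χ χ s s hs1 hs1 hreg hreg hz hz
  have hquad : χ.IsQuadratic := MulChar.isQuadratic_iff_sq_eq_one.mpr hsq
  have hseq : s = ((s.re : ℝ) : ℂ) := Complex.ext (by simp) (by simp [him])
  have hq3 : (3 : ℝ) ≤ q := by exact_mod_cast hq
  have hlogq : 1 < Real.log q := by
    rw [Real.lt_log_iff_exp_lt (by linarith)]
    have := Real.exp_one_lt_d9
    linarith
  have hMq : (q : ℝ) ≤ max (max (q : ℝ) ((q : ℝ) * |s.im|)) 10 :=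
    (le_max_left _ _).trans (le_max_left _ _)
  have hlogM : Real.log q ≤ Real.log (max (max (q : ℝ) ((q : ℝ) * |s.im|)) 10) :=
    Real.log_le_log (by linarith) hMq
  have hzc0 : 0 < zfrConst := by unfold zfrConst; norm_num
  have hzl : zfrConst ≤ landauConst := zfrConst_le_pageConst.trans pageConst_lt_landauConst.le
  have e : 1 / (9.645908801 * Real.log (max (max (q : ℝ) ((q : ℝ) * |s.im|)) 10)) =
      zfrConst / Real.log (max (max (q : ℝ) ((q : ℝ) * |s.im|)) 10) := by
    unfold zfrConst; rw [div_div]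
  have hc1 : zfrConst / Real.log (max (max (q : ℝ) ((q : ℝ) * |s.im|)) 10) ≤ zfrConst / Real.log q :=
    div_le_div_of_nonneg_left hzc0.le (by linarith) hlogM
  have hc2 : zfrConst / Real.log q ≤ landauConst / Real.log q :=
    div_le_div_of_nonneg_right hzl (by linarith)
  have hwin : 1 - landauConst / Real.log q ≤ s.re := by
    rw [e] at hreg
    linarith
  rw [hseq] at hz
  rw [hseq]
  exact deriv_ne_zero_of_realZero_landauWindow hq χ hquad h1 hz hwin

end McCurleyStechkin

open McCurleyStechkin ThornerZaman2024 in
/-- **Thorner–Zaman 2024, Theorem 2.6, the simplicity clause ("`β₁(Q)` is a simple zero of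
`𝓛(s,Q)`") — DERIVED modulo McCurley's Theorem 1 as printed and Platt 2016.** For `Q ≥ 3`, a
primitive `χ mod q`, `q ≤ Q`, and a REAL zero `β ≥ 1 − c/log Q` (`c = zfrConst = 1/9.645908801`) of
`L(s, χ)`: `χ` is quadratic and `L'(β, χ) ≠ 0`. (With `thornerZaman2024_corollary25_first`, no other
primitive quadratic character of modulus `≤ Q` vanishes at `β`, and by `McCurley1984_theorem1_closed`
no non-quadratic one does; so `β` is a simple zero of the product `𝓛(s,Q)`.) Platt's Theorems 7.1–7.2
give `q > 400 000` (`thornerZaman2024_corollary25_level_of_platt`), so McCurley's `max{q, 10} = q ≤ Q`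
and `deriv_ne_zero_of_mccurleyClosed` applies. [cite: ThornerZaman2024LogFree, Theorem 2.6]
[cite: McCurley1984ZFR, Theorem 1] [cite: Platt2016GRH, Theorems 7.1 and 7.2] -/
theorem thornerZaman2024_theorem26_simple_of_mccurleyClosed_platt (hM : McCurley1984_theorem1_closed)
    (h71 : platt2016_theorem71) (h72 : platt2016_theorem72) :
    ∀ Q : ℝ, 3 ≤ Q → ∀ (q : ℕ) [NeZero q] (χ : DirichletCharacter ℂ q), (q : ℝ) ≤ Q →
      χ.IsPrimitive → ∀ β : ℝ, χ.LFunction β = 0 → 1 - zfrConst / Real.log Q ≤ β →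
        χ.IsQuadratic ∧ deriv χ.LFunction β ≠ 0 := by
  intro Q hQ3 q _ χ hqQ hprim β hz hβ
  have hlogQ : 1 < Real.log Q := by
    rw [Real.lt_log_iff_exp_lt (by linarith)]
    have := Real.exp_one_lt_d9
    linarith
  have hzc0 : 0 < zfrConst := by unfold zfrConst; norm_num
  have hzc1 : zfrConst < 1 := by unfold zfrConst; norm_num
  have hwinP : 1 - pageConst / Real.log Q ≤ β := by
    have := div_le_div_of_nonneg_right zfrConst_le_pageConst (by linarith : (0 : ℝ) ≤ Real.log Q)
    linarith
  have hq4 : 400000 < q := thornerZaman2024_corollary25_level_of_platt h71 h72 hQ3 χ hprim hz hwinP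
  have hq3 : 3 ≤ q := by omega
  have hq3R : (3 : ℝ) ≤ q := by exact_mod_cast hq3
  have hq10 : (10 : ℝ) ≤ q := by exact_mod_cast (show 10 ≤ q by omega)
  have hβpos : 0 < β := by
    have : zfrConst / Real.log Q ≤ zfrConst := by
      rw [div_le_iff₀ (by linarith)]
      nlinarith
    linarith
  obtain ⟨-, hβ1⟩ := ne_one_and_lt_one hprim hβpos hz
  have hβne1 : (β : ℂ) ≠ 1 := by
    intro h
    have h' := congrArg Complex.re h
    simp only [ofReal_re, one_re] at h'
    linarith
  have hMq : max (max (q : ℝ) ((q : ℝ) * |((β : ℂ)).im|)) 10 = q := by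
    simp only [Complex.ofReal_im, abs_zero, mul_zero]
    rw [max_eq_left (by linarith : (0 : ℝ) ≤ q), max_eq_left hq10]
  have hreg : 1 - 1 / (9.645908801 * Real.log (max (max (q : ℝ) ((q : ℝ) * |((β : ℂ)).im|)) 10)) ≤
      ((β : ℂ)).re := by
    rw [hMq, Complex.ofReal_re]
    have e : 1 / (9.645908801 * Real.log q) = zfrConst / Real.log q := by
      unfold zfrConst; rw [div_div]
    rw [e]
    have hlogq0 : 0 < Real.log q := by
      have := Real.log_le_log (by norm_num : (0 : ℝ) < 3) hq3R
      have h3 : 1 < Real.log 3 := by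
        rw [Real.lt_log_iff_exp_lt (by norm_num)]
        have := Real.exp_one_lt_d9
        linarith
      linarith
    have : zfrConst / Real.log Q ≤ zfrConst / Real.log q :=
      div_le_div_of_nonneg_left hzc0.le hlogq0 (Real.log_le_log (by linarith) hqQ)
    linarith
  obtain ⟨-, -, -, hsq⟩ := hM q hq3 χ χ (β : ℂ) (β : ℂ) hβne1 hβne1 hreg hreg hz hz
  exact ⟨MulChar.isQuadratic_iff_sq_eq_one.mpr hsq, deriv_ne_zero_of_mccurleyClosed hM hq3 χ hβne1 hreg hz⟩

end Literature.NumberTheory.LFunctions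

end
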